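import Literature.Barriers.AtomisticToContinuum.AnticontinuumLocalizationEstimates
import Mathlib.Analysis.ODE.ExistUnique
import Mathlib.Analysis.SpecialFunctions.Trigonometric.Bounds
import Mathlib.MeasureTheory.Group.FundamentalDomain
import Mathlib.MeasureTheory.Group.Measure
import Mathlib.Algebra.Group.TransferInstance
import Mathlib.MeasureTheory.Integral.Prod
import Mathlib.MeasureTheory.Integral.IntervalIntegral.Basic
import Mathlib.MeasureTheory.Integral.DominatedConvergence
import Mathlib.MeasureTheory.Integral.Lebesgue.DominatedConvergence
import Mathlib.Topology.MetricSpace.HausdorffDistance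
import HarnessLib

/-!
# De Roeck–Huveneers 2015, Theorem 4 from Theorem 1: the printed proof (§7), with the rotor-chain calculus it needs

`Literature/Barriers/AtomisticToContinuum/` — companion ("Proofs" file) of
`AnticontinuumLocalization.lean`, which vendors W. De Roeck, F. Huveneers, *Asymptotic
localization of energy in nondisordered oscillator chains*, CPAM **68** (2015), arXiv:1305.5127,
as the named facts `DeRoeckHuveneers2015_thm1` (decomposition of the current, the paper's main
theorem, §§3–6), `DeRoeckHuveneers2015_thm2` (the barrier) and `DeRoeckHuveneers2015_thm4`
(frozen interval energies up to times `ε^{-n}`).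

## What is proved here

The paper proves Theorem 4 in ten lines (§7, "Proof of Theorem (the: nekoroshev)", arXiv p. 25):
"By the definition of the currents `J_{a,a+1}` we get `L_H(H_I) = εJ_{a₁,a₁+1} - εJ_{a₂,a₂+1}` so
that, by integrating over time the statement of Theorem 1,
`H_I(X^t_ε) - H_I = ∑_{j=1,2} (-1)^{j+1} (U_{a_j}(X^t_ε) - U_{a_j} + ε^{n+1} ∫₀ᵗ ds G_{a_j}(X^s_ε))`.
By invariance of the Gibbs state, we have `⟨(U_{a_j}(X^t_ε))²⟩_T = ⟨U²_{a_j}⟩_T` … Hence …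
`⟨(H_I(X^t_ε) - H_I)²⟩_T ≤ C(n) ∑_j (⟨U²_{a_j}⟩_T + ε^{2n+1}t²⟨G²_{a_j}⟩_T)`. The theorem now
follows by the bounds on `U_a, G_a` stated in Theorem 1, upon taking `t = ε^{-n}`."
(The incoming bond of `I = {a₁, …, a₂}` is `(a₁ - 1, a₁)`; with the free boundary it is absent
when `a₁` is the first site.)

This file formalizes exactly this reduction, for the Lean statements of the main file, and
PROVES the one input the paper takes for granted ("invariance of the Gibbs state" = Liouville's
theorem + conservation of energy + the torus periodicity). Everything below is proved; no named
fact is introduced: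

* `Literature.Barriers.AtomisticToContinuum.DeRoeckHuveneers2015_thm4_of_thm1 :
    DeRoeckHuveneers2015_thm1 → DeRoeckHuveneers2015_thm4`
  (constants `C = 36 max(C₁, 1)`, `ε < min(ε₀, 1)` from those of Theorem 1). The remaining
  hypothesis, Theorem 1, is the paper's main theorem (§§3–6, the KAM-type scheme) and is not
  attempted: an unconditional `DeRoeckHuveneers2015_thm4_holds` is exactly as hard as the paper.

Ingredients, all proved:

* rotor-chain calculus: `RotorChain.force` (closed form of `-∂_{q_x}H`, `partialQ_hamiltonian`),
  `field` (the Hamiltonian vector field `(ω, force)`), its smoothness, global Lipschitz bound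
  `fieldLipschitz = 1 + |ε|(|γ| + 4)` and sup bound, `fderiv_apply_field` (`DF·X_H = L_H F`);
* flow maps (`IsFlow` of the main file): Hamilton's equations in vector form
  (`IsFlow.hasDerivAt`), uniqueness of integral curves (`IsFlow.eq_orbit`, Mathlib's
  `ODE_solution_unique_univ`), the group property, commutation with the lattice `(2πℤ)^N` of angle
  shifts (`IsFlow.map_vadd`); the chain rule along the flow, its integrated form and conservation
  of energy are REUSED from `AnticontinuumLocalizationDynamics.lean` (`IsFlow.hasDerivAt_comp`,
  `IsFlow.integral_liouville`, `IsFlow.hamiltonian_apply`, landed for the Theorem 2 reduction);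
* the local energy balance `d/dt H_x = ε(J_{x-1,x} - J_{x,x+1})` (`IsFlow.hasDerivAt_siteEnergy`),
  its telescoped form for tails `∑_{x ≥ m} H_x` (`IsFlow.hasDerivAt_tailEnergy`) and the integrated
  balance of an interval (`IsFlow.intervalEnergy_sub_eq`) — the Lean form of
  "`L_H(H_I) = εJ_{a₁-1,a₁} - εJ_{a₂,a₂+1}`";
* **Liouville's theorem** `IsFlow.measurePreserving : MeasurePreserving (Φ t) volume volume`
  [Arnold 1989, §16 Thm 1] (Mathlib has no volume preservation by flows of divergence-free
  fields; searched `MeasurePreserving`+`flow`, `divergence`: the tree only has the hard-sphere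
  billiard flow `Literature.Analysis.FluidPDE.HardSphereAlexander` and shear flows). Proof by
  SYMPLECTIC-EULER SPLITTING, which avoids Jacobians: the shears `(q, ω) ↦ (q + hω, ω)` and
  `(q, ω) ↦ (q, ω + hF(q))` preserve volume exactly (Fubini, `MeasurePreserving.skew_product`),
  the scheme converges to the flow (`IsFlow.tendsto_iterate_eulerStep`: consistency
  `‖step_h(Φ_s z) - Φ_{s+h} z‖ ≤ Ch²` along a bounded orbit and a discrete Grönwall argument with
  the Lipschitz constant `(1+h)(1+hL) ≤ e^{h(1+L)}` of one step), dominated convergence gives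
  `∫ g∘Φ_t = ∫ g` for `g ∈ C_c` (`IsFlow.lintegral_comp_eq_of_hasCompactSupport`, using the
  backward confinement `norm_le_of_norm_iterate_eulerStep_le` of the scheme), monotone
  approximation gives `vol(Φ_t⁻¹O) = vol O` for bounded open `O`, and the bounded open sets are a
  generating π-system (`measure_eq_volume_of_isOpen`); negative times by the group property;
* the lattice `AngleShift N ≅ ℤ^N` acting on the lifted phase space `ℝ^N × ℝ^N` by `q ↦ q + 2πk`,
  `[0, 2π)^N × ℝ^N` (`domain`) as an exact fundamental domain, and the passage
  "Liouville + energy conservation ⟹ `⟨F ∘ X^t⟩_T = ⟨F⟩_T` for every measurable `F ≥ 0` on `Ω_N`"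
  (`IsFlow.lintegral_comp_eq`, `IsFlow.stationary`; Mathlib's
  `IsAddFundamentalDomain.setLIntegral_eq` applied to the two fundamental domains `D` and `Φ_t⁻¹ D`
  of the `Φ_t`- and shift-invariant measure `e^{-H/T} dq dω`);
* the analytic steps of §7: stationarity + Tonelli `⟨∫₀ᵗ G(X^s)² ds⟩ = t⟨G²⟩`
  (`IsFlow.lintegral_ofReal_intervalIntegral_sq`) and the one-bond estimate
  `⟨(ε∫₀ᵗ J_{y,y+1}(X^s) ds)²⟩_T ≤ 9Cε^{1/4}` for `0 ≤ t ≤ ε^{-n}`, `ε ≤ 1` (`IsFlow.bond_estimate`);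
  Jensen `(∫₀ᵗ g)² ≤ t∫₀ᵗ g²` is REUSED from `AnticontinuumLocalizationEstimates.lean`
  (`sq_intervalIntegral_le`), whose abstract stationarity hypothesis `hinv` is exactly the
  conclusion of `IsFlow.stationary` here (so the Theorem 2 reduction can be fed by this file).

## Design notes

* All estimates are carried out with `∫⁻`/`ℝ≥0∞` (no integrability side conditions until the
  end); integrability of `(H_I(X^t) - H_I)²` then follows from continuity and the finite bound
  (`lintegral_ofReal_ne_top_iff_integrable`). Nothing about the partition function is needed: the
  Gibbs state `gibbsMeasure` of the main file is `Z⁻¹ • (e^{-H/T} dq dω)|_D` and the argument is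
  homogeneous in the normalisation (`gibbsMeasure_eq`); `SFinite` holds for any scalar.
* Liouville's theorem is proved for every map satisfying `IsFlow` (by `IsFlow.eq_orbit` such a
  map IS the flow, global since the field is globally Lipschitz) and all `N, ε, γ, t`.
* The lattice is a one-field structure `AngleShift N` (not an instance on `Fin N → ℤ`) so that the
  `AddAction`/`MeasurableConstVAdd`/`VAddInvariantMeasure` instances are on this file's own type.

## References

* W. De Roeck, F. Huveneers, CPAM 68 (2015) 1532–1568, arXiv:1305.5127: §2.1–2.3, Thm 1, Thm 4,
  §7 proof of Thm 4 (arXiv p. 25). [DeRoeckHuveneers2015]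
* V. I. Arnold, *Mathematical Methods of Classical Mechanics*, 2nd ed., GTM 60 (1989), §16
  Liouville's theorem, Thm 1 and Thm 2 (held copy PDF pp. 65–66). [Arnold1989]
-/

noncomputable section

open MeasureTheory Filter Set
open scoped ContDiff ENNReal Topology

namespace Literature.Barriers.AtomisticToContinuum.HeatConduction

open Literature.MathematicalPhysics.KineticTheory.HeatConduction

namespace RotorChain

variable {N : ℕ}

/-! ### Closed form of `∂_{q_x} H`; the Hamiltonian vector field -/

/-- The `ε`-free part of the force on rotor `x`:
`γ sin q_x + ∑_{y = x+1} sin(q_x - q_y) - ∑_{x = y+1} sin(q_y - q_x)`. [folklore] -/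
def forceCore (N : ℕ) (γ : ℝ) (q : Fin N → ℝ) (x : Fin N) : ℝ :=
  γ * Real.sin (q x) +
      ∑ y : Fin N, (if y.val = x.val + 1 then Real.sin (q x - q y) else 0) -
      ∑ y : Fin N, (if x.val = y.val + 1 then Real.sin (q y - q x) else 0)

/-- The force on rotor `x`: `-∂_{q_x} H = -ε (γ sin q_x + ∑_{y = x+1} sin(q_x - q_y) - ∑_{x = y+1} sin(q_y - q_x))`.
[cite: DeRoeckHuveneers2015, §2.1 eq. (2.2)] -/
def force (N : ℕ) (ε γ : ℝ) (q : Fin N → ℝ) (x : Fin N) : ℝ :=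
  -(ε * forceCore N γ q x)

/-- `t ↦ H(q[x ↦ t], ω)` has derivative `-force` at `t = q_x`. [folklore] -/
theorem hasDerivAt_hamiltonian_update (ε γ : ℝ) (z : PhaseSpace N) (x : Fin N) :
    HasDerivAt (fun t => hamiltonian N ε γ (Function.update z.1 x t, z.2))
      (-force N ε γ z.1 x) (z.1 x) := by
  -- coordinates of the updated configuration
  have hx : ∀ y : Fin N, HasDerivAt (fun t => Function.update z.1 x t y)
      (if y = x then 1 else 0) (z.1 x) := fun y => by
    by_cases hy : y = x
    · subst hy; simp only [Function.update_self, if_true]; exact hasDerivAt_id _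
    · simp only [Function.update_of_ne hy, hy, if_false]; exact hasDerivAt_const _ _
  have h0 : ∀ y : Fin N, Function.update z.1 x (z.1 x) y = z.1 y := fun y => by simp
  -- derivative of the site energy of site `y`
  let D : Fin N → ℝ := fun y => ε * (γ * (Real.sin (z.1 y) * (if y = x then 1 else 0)) +
      ∑ w : Fin N, if w.val = y.val + 1 then
        Real.sin (z.1 y - z.1 w) * ((if y = x then 1 else 0) - (if w = x then 1 else 0)) else 0)
  have hsite : ∀ y : Fin N, HasDerivAt
      (fun t => z.2 y ^ 2 / 2 + ε * (γ * (1 - Real.cos (Function.update z.1 x t y)) +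
        ∑ w : Fin N, if w.val = y.val + 1 then
          (1 - Real.cos (Function.update z.1 x t y - Function.update z.1 x t w)) else 0)) (D y) (z.1 x) :=
      fun y => by
    have h1 : HasDerivAt (fun t => γ * (1 - Real.cos (Function.update z.1 x t y)))
        (γ * (Real.sin (z.1 y) * (if y = x then 1 else 0))) (z.1 x) := by
      refine (((hx y).cos.const_sub 1).const_mul γ).congr_deriv ?_
      rw [h0]; ring
    have h2 : ∀ w : Fin N, HasDerivAt (fun t => if w.val = y.val + 1 then
          (1 - Real.cos (Function.update z.1 x t y - Function.update z.1 x t w)) else 0)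
        (if w.val = y.val + 1 then
          Real.sin (z.1 y - z.1 w) * ((if y = x then 1 else 0) - (if w = x then 1 else 0)) else 0)
        (z.1 x) := fun w => by
      by_cases hw : w.val = y.val + 1
      · simp only [hw, if_true]
        refine (((hx y).sub (hx w)).cos.const_sub 1).congr_deriv ?_
        simp only [Pi.sub_apply, h0]; ring
      · simp only [hw, if_false]; exact hasDerivAt_const _ _
    exact ((h1.add (HasDerivAt.fun_sum fun w _ => h2 w)).const_mul ε).const_add (z.2 y ^ 2 / 2)
  have hderiv : HasDerivAt (fun t => hamiltonian N ε γ (Function.update z.1 x t, z.2))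
      (∑ y : Fin N, D y) (z.1 x) := by
    show HasDerivAt (fun t => ∑ y : Fin N, (z.2 y ^ 2 / 2 + ε * (γ * (1 - Real.cos (Function.update z.1 x t y)) +
        ∑ w : Fin N, if w.val = y.val + 1 then
          (1 - Real.cos (Function.update z.1 x t y - Function.update z.1 x t w)) else 0))) _ _
    exact HasDerivAt.fun_sum fun y _ => hsite y
  -- algebra: `∑_y D y = -force`
  have hD : ∀ y : Fin N, D y = ε * ((if y = x then γ * Real.sin (z.1 y) +
      ∑ w : Fin N, (if w.val = y.val + 1 then Real.sin (z.1 y - z.1 w) else 0) else 0) -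
      (if x.val = y.val + 1 then Real.sin (z.1 y - z.1 x) else 0)) := fun y => by
    simp only [D]
    congr 1
    have hsplit : ∀ w : Fin N, (if w.val = y.val + 1 then
        Real.sin (z.1 y - z.1 w) * ((if y = x then 1 else 0) - (if w = x then 1 else 0)) else 0) =
        (if y = x then (if w.val = y.val + 1 then Real.sin (z.1 y - z.1 w) else 0) else 0) -
        (if w = x then (if w.val = y.val + 1 then Real.sin (z.1 y - z.1 w) else 0) else 0) := by
      intro w; split_ifs <;> ring
    simp_rw [hsplit]
    rw [Finset.sum_sub_distrib, Finset.sum_ite_eq' Finset.univ x, if_pos (Finset.mem_univ x)]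
    by_cases hy : y = x
    · subst hy
      have hne : ¬ (y.val = y.val + 1) := by omega
      simp
    · simp [hy]
  have hsum : ∑ y : Fin N, D y = -force N ε γ z.1 x := by
    simp_rw [hD]
    rw [← Finset.mul_sum, Finset.sum_sub_distrib, Finset.sum_ite_eq' Finset.univ x,
      if_pos (Finset.mem_univ x)]
    unfold force forceCore
    ring
  rw [← hsum]
  exact hderiv

/-- **`∂_{q_x} H = -force_x`.** [folklore] -/
theorem partialQ_hamiltonian (ε γ : ℝ) (z : PhaseSpace N) (x : Fin N) :
    partialQ x (hamiltonian N ε γ) z = -force N ε γ z.1 x :=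
  (hasDerivAt_hamiltonian_update ε γ z x).deriv

/-! ### Elementary bounds on the one-bond sums -/

/-- A sum over the (at most one) right neighbour `y = x + 1` is bounded by the bound on its term.
[folklore] -/
theorem abs_sum_ite_succ_le {f : Fin N → ℝ} {B : ℝ} (hB : 0 ≤ B) (hf : ∀ y, |f y| ≤ B) (x : Fin N) :
    |∑ y : Fin N, (if y.val = x.val + 1 then f y else 0)| ≤ B := by
  by_cases h : x.val + 1 < N
  · rw [Finset.sum_eq_single_of_mem (⟨x.val + 1, h⟩ : Fin N) (Finset.mem_univ _)]
    · simpa using hf ⟨x.val + 1, h⟩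
    · intro y _ hy
      rw [if_neg]
      exact fun e => hy (Fin.ext e)
  · rw [Finset.sum_eq_zero]
    · simpa using hB
    · intro y _
      rw [if_neg]
      have := y.isLt
      omega

/-- A sum over the (at most one) left neighbour `y = x - 1` is bounded by the bound on its term.
[folklore] -/
theorem abs_sum_ite_pred_le {f : Fin N → ℝ} {B : ℝ} (hB : 0 ≤ B) (hf : ∀ y, |f y| ≤ B) (x : Fin N) :
    |∑ y : Fin N, (if x.val = y.val + 1 then f y else 0)| ≤ B := by
  by_cases h : 0 < x.val
  · have hlt : x.val - 1 < N := by have := x.isLt; omega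
    rw [Finset.sum_eq_single_of_mem (⟨x.val - 1, hlt⟩ : Fin N) (Finset.mem_univ _)]
    · have : x.val = (x.val - 1) + 1 := by omega
      simp only [← this, if_true]
      exact hf _
    · intro y _ hy
      rw [if_neg]
      intro e
      apply hy
      exact Fin.ext (by simp; omega)
  · rw [Finset.sum_eq_zero]
    · simpa using hB
    · intro y _
      rw [if_neg]
      omega

/-- `|a + b - c| ≤ |a| + |b| + |c|`. [folklore] -/
theorem abs_add_sub_le_three (a b c : ℝ) : |a + b - c| ≤ |a| + |b| + |c| := by
  calc |a + b - c| ≤ |a + b| + |c| := abs_sub _ _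
    _ ≤ |a| + |b| + |c| := by gcongr; exact abs_add_le _ _

/-- `|force_x| ≤ |ε| (|γ| + 2)`. [folklore] -/
theorem abs_force_le (ε γ : ℝ) (q : Fin N → ℝ) (x : Fin N) :
    |force N ε γ q x| ≤ |ε| * (|γ| + 2) := by
  unfold force forceCore
  rw [abs_neg, abs_mul]
  refine mul_le_mul_of_nonneg_left ?_ (abs_nonneg ε)
  have h1 : |γ * Real.sin (q x)| ≤ |γ| := by
    rw [abs_mul]
    exact mul_le_of_le_one_right (abs_nonneg γ) (Real.abs_sin_le_one _)
  have h2 := abs_sum_ite_succ_le (N := N) zero_le_one (fun y => Real.abs_sin_le_one (q x - q y)) x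
  have h3 := abs_sum_ite_pred_le (N := N) zero_le_one (fun y => Real.abs_sin_le_one (q y - q x)) x
  calc |γ * Real.sin (q x) + ∑ y : Fin N, (if y.val = x.val + 1 then Real.sin (q x - q y) else 0) -
        ∑ y : Fin N, (if x.val = y.val + 1 then Real.sin (q y - q x) else 0)|
      ≤ |γ * Real.sin (q x)| + |∑ y : Fin N, (if y.val = x.val + 1 then Real.sin (q x - q y) else 0)| +
        |∑ y : Fin N, (if x.val = y.val + 1 then Real.sin (q y - q x) else 0)| := abs_add_sub_le_three _ _ _
    _ ≤ |γ| + 1 + 1 := by gcongr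
    _ = |γ| + 2 := by ring

/-- `‖force q‖ ≤ |ε| (|γ| + 2)` (sup norm). [folklore] -/
theorem norm_force_le (ε γ : ℝ) (q : Fin N → ℝ) : ‖force N ε γ q‖ ≤ |ε| * (|γ| + 2) :=
  (pi_norm_le_iff_of_nonneg (by positivity)).2 fun x => by
    rw [Real.norm_eq_abs]; exact abs_force_le ε γ q x

/-- `forceCore` is Lipschitz in the configuration with constant `|γ| + 4` (sup norm). [folklore] -/
theorem abs_forceCore_sub_le (γ : ℝ) (q q' : Fin N → ℝ) (x : Fin N) :
    |forceCore N γ q x - forceCore N γ q' x| ≤ (|γ| + 4) * ‖q - q'‖ := by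
  have hq : ∀ y, |q y - q' y| ≤ ‖q - q'‖ := fun y => by
    rw [← Real.norm_eq_abs]; exact norm_le_pi_norm (q - q') y
  have hsin1 : ∀ y, |Real.sin (q x - q y) - Real.sin (q' x - q' y)| ≤ 2 * ‖q - q'‖ := fun y => by
    calc |Real.sin (q x - q y) - Real.sin (q' x - q' y)| ≤ |(q x - q y) - (q' x - q' y)| :=
          Real.abs_sin_sub_sin_le _ _
      _ = |(q x - q' x) - (q y - q' y)| := by ring_nf
      _ ≤ |q x - q' x| + |q y - q' y| := abs_sub _ _
      _ ≤ ‖q - q'‖ + ‖q - q'‖ := add_le_add (hq x) (hq y)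
      _ = 2 * ‖q - q'‖ := by ring
  have hsin2 : ∀ y, |Real.sin (q y - q x) - Real.sin (q' y - q' x)| ≤ 2 * ‖q - q'‖ := fun y => by
    calc |Real.sin (q y - q x) - Real.sin (q' y - q' x)| ≤ |(q y - q x) - (q' y - q' x)| :=
          Real.abs_sin_sub_sin_le _ _
      _ = |(q y - q' y) - (q x - q' x)| := by ring_nf
      _ ≤ |q y - q' y| + |q x - q' x| := abs_sub _ _
      _ ≤ ‖q - q'‖ + ‖q - q'‖ := add_le_add (hq y) (hq x)
      _ = 2 * ‖q - q'‖ := by ring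
  have h0 : 0 ≤ 2 * ‖q - q'‖ := by positivity
  have hS1 := abs_sum_ite_succ_le (N := N) h0 hsin1 x
  have hS2 := abs_sum_ite_pred_le (N := N) h0 hsin2 x
  have hγ : |γ * Real.sin (q x) - γ * Real.sin (q' x)| ≤ |γ| * ‖q - q'‖ := by
    rw [← mul_sub, abs_mul]
    refine mul_le_mul_of_nonneg_left ?_ (abs_nonneg γ)
    exact (Real.abs_sin_sub_sin_le _ _).trans (hq x)
  have e1 : ∑ y : Fin N, (if y.val = x.val + 1 then Real.sin (q x - q y) else 0) -
      ∑ y : Fin N, (if y.val = x.val + 1 then Real.sin (q' x - q' y) else 0) =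
      ∑ y : Fin N, (if y.val = x.val + 1 then Real.sin (q x - q y) - Real.sin (q' x - q' y) else 0) := by
    rw [← Finset.sum_sub_distrib]
    refine Finset.sum_congr rfl fun y _ => ?_
    split_ifs <;> ring
  have e2 : ∑ y : Fin N, (if x.val = y.val + 1 then Real.sin (q y - q x) else 0) -
      ∑ y : Fin N, (if x.val = y.val + 1 then Real.sin (q' y - q' x) else 0) =
      ∑ y : Fin N, (if x.val = y.val + 1 then Real.sin (q y - q x) - Real.sin (q' y - q' x) else 0) := by
    rw [← Finset.sum_sub_distrib]
    refine Finset.sum_congr rfl fun y _ => ?_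
    split_ifs <;> ring
  unfold forceCore
  calc _ = |(γ * Real.sin (q x) - γ * Real.sin (q' x)) +
        (∑ y : Fin N, (if y.val = x.val + 1 then Real.sin (q x - q y) else 0) -
          ∑ y : Fin N, (if y.val = x.val + 1 then Real.sin (q' x - q' y) else 0)) -
        (∑ y : Fin N, (if x.val = y.val + 1 then Real.sin (q y - q x) else 0) -
          ∑ y : Fin N, (if x.val = y.val + 1 then Real.sin (q' y - q' x) else 0))| := by
        congr 1; ring
    _ ≤ |γ * Real.sin (q x) - γ * Real.sin (q' x)| +
        |∑ y : Fin N, (if y.val = x.val + 1 then Real.sin (q x - q y) else 0) -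
          ∑ y : Fin N, (if y.val = x.val + 1 then Real.sin (q' x - q' y) else 0)| +
        |∑ y : Fin N, (if x.val = y.val + 1 then Real.sin (q y - q x) else 0) -
          ∑ y : Fin N, (if x.val = y.val + 1 then Real.sin (q' y - q' x) else 0)| :=
        abs_add_sub_le_three _ _ _
    _ ≤ |γ| * ‖q - q'‖ + 2 * ‖q - q'‖ + 2 * ‖q - q'‖ := by
        rw [e1, e2]; gcongr
    _ = (|γ| + 4) * ‖q - q'‖ := by ring

/-- The force is Lipschitz in the configuration: `|force_x(q) - force_x(q')| ≤ |ε|(|γ| + 4) ‖q - q'‖`.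
[folklore] -/
theorem abs_force_sub_force_le (ε γ : ℝ) (q q' : Fin N → ℝ) (x : Fin N) :
    |force N ε γ q x - force N ε γ q' x| ≤ |ε| * (|γ| + 4) * ‖q - q'‖ := by
  unfold force
  rw [show -(ε * forceCore N γ q x) - -(ε * forceCore N γ q' x) =
      -(ε * (forceCore N γ q x - forceCore N γ q' x)) by ring, abs_neg, abs_mul, mul_assoc]
  exact mul_le_mul_of_nonneg_left (abs_forceCore_sub_le γ q q' x) (abs_nonneg ε)

/-- `‖force q - force q'‖ ≤ |ε|(|γ| + 4) ‖q - q'‖`. [folklore] -/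
theorem norm_force_sub_force_le (ε γ : ℝ) (q q' : Fin N → ℝ) :
    ‖force N ε γ q - force N ε γ q'‖ ≤ |ε| * (|γ| + 4) * ‖q - q'‖ :=
  (pi_norm_le_iff_of_nonneg (by positivity)).2 fun x => by
    rw [Pi.sub_apply, Real.norm_eq_abs]; exact abs_force_sub_force_le ε γ q q' x

/-! ### The Hamiltonian vector field and the flow -/

/-- The Hamiltonian vector field `X_H(q, ω) = (∇_ω H, -∇_q H) = (ω, force(q))` of the rotor chain.
[cite: DeRoeckHuveneers2015, §2.1 eq. (2.2)] -/
def field (N : ℕ) (ε γ : ℝ) (z : PhaseSpace N) : PhaseSpace N :=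
  (z.2, force N ε γ z.1)

/-- `forceCore` is smooth in the configuration. [folklore] -/
theorem contDiff_forceCore (N : ℕ) (γ : ℝ) (x : Fin N) {n : WithTop ℕ∞} :
    ContDiff ℝ n fun q : Fin N → ℝ => forceCore N γ q x := by
  unfold forceCore
  refine ((contDiff_const.mul (Real.contDiff_sin.comp (contDiff_apply ℝ ℝ x))).add
    (ContDiff.sum fun y _ => ?_)).sub (ContDiff.sum fun y _ => ?_)
  · by_cases h : y.val = x.val + 1
    · simp only [h, if_true]
      exact Real.contDiff_sin.comp ((contDiff_apply ℝ ℝ x).sub (contDiff_apply ℝ ℝ y))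
    · simp only [h, if_false]; exact contDiff_const
  · by_cases h : x.val = y.val + 1
    · simp only [h, if_true]
      exact Real.contDiff_sin.comp ((contDiff_apply ℝ ℝ y).sub (contDiff_apply ℝ ℝ x))
    · simp only [h, if_false]; exact contDiff_const

/-- The rotor field is smooth. [folklore] -/
theorem contDiff_field (N : ℕ) (ε γ : ℝ) : ContDiff ℝ ∞ (field N ε γ) := by
  refine contDiff_snd.prodMk (contDiff_pi.2 fun x => ?_)
  show ContDiff ℝ ∞ fun z : PhaseSpace N => -(ε * forceCore N γ z.1 x)
  exact (contDiff_const.mul ((contDiff_forceCore N γ x).comp contDiff_fst)).neg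

/-- The rotor field is continuous. [folklore] -/
theorem continuous_field (N : ℕ) (ε γ : ℝ) : Continuous (field N ε γ) :=
  (contDiff_field N ε γ).continuous

/-- The Lipschitz constant `1 + |ε|(|γ| + 4)` of the rotor field. [folklore] -/
def fieldLipschitz (ε γ : ℝ) : NNReal := ⟨1 + |ε| * (|γ| + 4), by positivity⟩

/-- The rotor field is globally Lipschitz. [folklore] -/
theorem lipschitzWith_field (N : ℕ) (ε γ : ℝ) : LipschitzWith (fieldLipschitz ε γ) (field N ε γ) := by
  refine lipschitzWith_iff_norm_sub_le.2 fun z z' => ?_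
  simp only [fieldLipschitz]
  rw [Prod.norm_def]
  refine max_le ?_ ?_
  · calc ‖(field N ε γ z - field N ε γ z').1‖ = ‖(z - z').2‖ := rfl
      _ ≤ ‖z - z'‖ := norm_snd_le _
      _ ≤ (1 + |ε| * (|γ| + 4)) * ‖z - z'‖ := by
          refine le_mul_of_one_le_left (norm_nonneg _) ?_
          have : 0 ≤ |ε| * (|γ| + 4) := by positivity
          linarith
  · calc ‖(field N ε γ z - field N ε γ z').2‖ = ‖force N ε γ z.1 - force N ε γ z'.1‖ := rfl
      _ ≤ |ε| * (|γ| + 4) * ‖z.1 - z'.1‖ := norm_force_sub_force_le ε γ z.1 z'.1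
      _ ≤ |ε| * (|γ| + 4) * ‖z - z'‖ := by
          refine mul_le_mul_of_nonneg_left ?_ (by positivity)
          exact norm_fst_le (z - z')
      _ ≤ (1 + |ε| * (|γ| + 4)) * ‖z - z'‖ := by
          refine mul_le_mul_of_nonneg_right ?_ (norm_nonneg _)
          linarith

variable {ε γ : ℝ} {Φ : ℝ → PhaseSpace N → PhaseSpace N}

/-- A flow map is jointly continuous. [folklore] -/
theorem IsFlow.continuous (hΦ : IsFlow N ε γ Φ) : Continuous fun p : ℝ × PhaseSpace N => Φ p.1 p.2 :=
  hΦ.1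

/-- `Φ_0 = id`. [folklore] -/
theorem IsFlow.map_zero (hΦ : IsFlow N ε γ Φ) (z : PhaseSpace N) : Φ 0 z = z :=
  hΦ.2.1 z

/-- Each `Φ_t` is continuous. [folklore] -/
theorem IsFlow.continuous_at (hΦ : IsFlow N ε γ Φ) (t : ℝ) : Continuous (Φ t) :=
  hΦ.1.comp (continuous_const.prodMk continuous_id)

/-- Each orbit `t ↦ Φ_t z` is continuous. [folklore] -/
theorem IsFlow.continuous_orbit (hΦ : IsFlow N ε γ Φ) (z : PhaseSpace N) : Continuous fun t => Φ t z :=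
  hΦ.1.comp (continuous_id.prodMk continuous_const)

/-- Each `Φ_t` is measurable. [folklore] -/
theorem IsFlow.measurable (hΦ : IsFlow N ε γ Φ) (t : ℝ) : Measurable (Φ t) :=
  (hΦ.continuous_at t).measurable

/-- Hamilton's equations in vector form: `d/dt Φ_t z = X_H(Φ_t z)`. [cite: DeRoeckHuveneers2015, §2.1 eq. (2.2)] -/
theorem IsFlow.hasDerivAt (hΦ : IsFlow N ε γ Φ) (z : PhaseSpace N) (t : ℝ) :
    HasDerivAt (fun s => Φ s z) (field N ε γ (Φ t z)) t := by
  refine HasDerivAt.prodMk (hasDerivAt_pi.2 fun x => (hΦ.2.2 z x t).1) (hasDerivAt_pi.2 fun x => ?_)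
  have := (hΦ.2.2 z x t).2
  rw [partialQ_hamiltonian, neg_neg] at this
  exact this

/-- **Uniqueness**: an integral curve of the rotor field is an orbit of any flow map.
[folklore] -/
theorem IsFlow.eq_orbit (hΦ : IsFlow N ε γ Φ) {f : ℝ → PhaseSpace N}
    (hf : ∀ t, HasDerivAt f (field N ε γ (f t)) t) : f = fun t => Φ t (f 0) :=
  ODE_solution_unique_univ (v := fun _ => field N ε γ) (s := fun _ => univ) (t₀ := 0)
    (fun _ => (lipschitzWith_field N ε γ).lipschitzOnWith) (fun t => ⟨hf t, mem_univ _⟩)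
    (fun t => ⟨hΦ.hasDerivAt (f 0) t, mem_univ _⟩) (by rw [hΦ.map_zero])

/-- The group property `Φ_{s+t} = Φ_s ∘ Φ_t`. [folklore] -/
theorem IsFlow.map_add (hΦ : IsFlow N ε γ Φ) (s t : ℝ) (z : PhaseSpace N) :
    Φ (s + t) z = Φ s (Φ t z) := by
  have h := hΦ.eq_orbit (f := fun s => Φ (s + t) z) fun s => by
    have := hΦ.hasDerivAt z (s + t)
    exact this.comp_add_const s t
  have := congrFun h s
  simpa using this

/-! ### Observables along the flow: the Liouville operator is the time derivative -/

/-- For differentiable `F`, `DF(z) · X_H(z) = L_H F (z) = {H, F}(z)`. [cite: DeRoeckHuveneers2015, §2.2 eq. (2.4)] -/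
theorem fderiv_apply_field {F : PhaseSpace N → ℝ} (hF : Differentiable ℝ F) (ε γ : ℝ) (z : PhaseSpace N) :
    fderiv ℝ F z (field N ε γ z) = liouville N ε γ F z := by
  rw [fderiv_apply_eq_sum hF]
  unfold liouville
  refine Finset.sum_congr rfl fun i _ => ?_
  rw [partialP_hamiltonian, partialQ_hamiltonian]
  simp only [field]
  ring

/-! ### Currents and the local energy balance -/

/-- The energy current INTO site `x` from its left neighbour: `ω_x sin(q_{x-1} - q_x)` (zero for
the first site). [cite: DeRoeckHuveneers2015, §2.2 eq. (2.5) and §2.4] -/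
def inCurrent (N : ℕ) (x : Fin N) (z : PhaseSpace N) : ℝ :=
  ∑ y : Fin N, if x.val = y.val + 1 then z.2 x * Real.sin (z.1 y - z.1 x) else 0

/-- The current into `x` is the bond current of the bond `(x-1, x)`. [folklore] -/
theorem inCurrent_eq_sum_bondCurrent (x : Fin N) (z : PhaseSpace N) :
    inCurrent N x z = ∑ y : Fin N, if x.val = y.val + 1 then bondCurrent N y z else 0 := by
  unfold inCurrent bondCurrent
  refine Finset.sum_congr rfl fun y _ => ?_
  by_cases hy : x.val = y.val + 1
  · simp only [hy, if_true]
    rw [Finset.sum_eq_single_of_mem x (Finset.mem_univ _) (fun w _ hw => if_neg fun e =>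
      hw (Fin.ext (by omega)))]
    rw [if_pos hy]
  · simp only [hy, if_false]

/-- The algebra of the local energy balance: `ω_x F_x + ε d/dt V_x = ε (J_{x-1,x} - J_{x,x+1})`.
[folklore] -/
theorem energyBalance_identity (ε γ : ℝ) (q p : Fin N → ℝ) (x : Fin N) :
    p x * force N ε γ q x + ε * (γ * (Real.sin (q x) * p x) +
      ∑ y : Fin N, (if y.val = x.val + 1 then Real.sin (q x - q y) * (p x - p y) else 0)) =
    ε * (inCurrent N x (q, p) - bondCurrent N x (q, p)) := by
  unfold force forceCore inCurrent bondCurrent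
  have hS3 : ∑ y : Fin N, (if y.val = x.val + 1 then Real.sin (q x - q y) * (p x - p y) else 0) =
      p x * ∑ y : Fin N, (if y.val = x.val + 1 then Real.sin (q x - q y) else 0) -
        ∑ y : Fin N, (if y.val = x.val + 1 then p y * Real.sin (q x - q y) else 0) := by
    rw [Finset.mul_sum, ← Finset.sum_sub_distrib]
    refine Finset.sum_congr rfl fun y _ => ?_
    split_ifs <;> ring
  have hS4 : ∑ y : Fin N, (if x.val = y.val + 1 then p x * Real.sin (q y - q x) else 0) =
      p x * ∑ y : Fin N, (if x.val = y.val + 1 then Real.sin (q y - q x) else 0) := by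
    rw [Finset.mul_sum]
    refine Finset.sum_congr rfl fun y _ => ?_
    split_ifs <;> ring
  simp only []
  rw [hS3, hS4]
  ring

/-- **Local energy balance**: `d/dt H_x(Φ_t z) = ε (J_{x-1,x} - J_{x,x+1})(Φ_t z)`.
[cite: DeRoeckHuveneers2015, §2.2 eq. (2.5)] -/
theorem IsFlow.hasDerivAt_siteEnergy (hΦ : IsFlow N ε γ Φ) (z : PhaseSpace N) (x : Fin N) (t : ℝ) :
    HasDerivAt (fun s => siteEnergy N ε γ (Φ s z) x)
      (ε * (inCurrent N x (Φ t z) - bondCurrent N x (Φ t z))) t := by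
  have hq : ∀ y : Fin N, HasDerivAt (fun s => (Φ s z).1 y) ((Φ t z).2 y) t := fun y => (hΦ.2.2 z y t).1
  have hp : HasDerivAt (fun s => (Φ s z).2 x) (force N ε γ (Φ t z).1 x) t := by
    have := (hΦ.2.2 z x t).2
    rwa [partialQ_hamiltonian, neg_neg] at this
  -- kinetic part
  have hkin : HasDerivAt (fun s => (Φ s z).2 x ^ 2 / 2) ((Φ t z).2 x * force N ε γ (Φ t z).1 x) t := by
    have := (hp.pow 2).div_const 2
    refine this.congr_deriv ?_
    simp; ring
  -- potential part
  have hpot : HasDerivAt (fun s => sitePotential N γ (Φ s z).1 x)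
      (γ * (Real.sin ((Φ t z).1 x) * (Φ t z).2 x) +
        ∑ y : Fin N, if y.val = x.val + 1 then
          Real.sin ((Φ t z).1 x - (Φ t z).1 y) * ((Φ t z).2 x - (Φ t z).2 y) else 0) t := by
    unfold sitePotential
    refine (((hq x).cos.const_sub 1).const_mul γ |>.congr_deriv (by ring)).add
      (HasDerivAt.fun_sum fun y _ => ?_)
    by_cases hy : y.val = x.val + 1
    · simp only [hy, if_true]
      exact (((hq x).sub (hq y)).cos.const_sub 1).congr_deriv (by simp only [Pi.sub_apply]; ring)
    · simp only [hy, if_false]; exact hasDerivAt_const _ _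
  have h := hkin.add (hpot.const_mul ε)
  exact h.congr_deriv (energyBalance_identity ε γ (Φ t z).1 (Φ t z).2 x)

/-- The energy `∑_{x ≥ m} H_x` to the right of (and including) site `m`. [folklore] -/
def tailEnergy (N : ℕ) (ε γ : ℝ) (m : ℕ) (z : PhaseSpace N) : ℝ :=
  ∑ x : Fin N, if m ≤ x.val then siteEnergy N ε γ z x else 0

/-- The current flowing into the tail `{x ≥ m}`: the bond current of the bond `(m-1, m)` (zero if
there is no such bond). [folklore] -/
def tailCurrent (N : ℕ) (m : ℕ) (z : PhaseSpace N) : ℝ :=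
  ∑ y : Fin N, if y.val + 1 = m then bondCurrent N y z else 0

/-- The energy of the interval `{a₁, …, a₂}` is a difference of two tail energies. [folklore] -/
theorem intervalEnergy_eq_tailEnergy_sub {a₁ a₂ : Fin N} (h : a₁ ≤ a₂) (ε γ : ℝ) (z : PhaseSpace N) :
    intervalEnergy N ε γ a₁ a₂ z = tailEnergy N ε γ a₁.val z - tailEnergy N ε γ (a₂.val + 1) z := by
  unfold intervalEnergy tailEnergy
  rw [← Finset.sum_sub_distrib, ← Finset.sum_filter_add_sum_filter_not Finset.univ (· ∈ Finset.Icc a₁ a₂)]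
  rw [Finset.filter_mem_eq_inter, Finset.univ_inter]
  have h2 : ∑ x ∈ Finset.univ.filter (fun x => ¬ x ∈ Finset.Icc a₁ a₂),
      ((if a₁.val ≤ x.val then siteEnergy N ε γ z x else 0) -
        (if a₂.val + 1 ≤ x.val then siteEnergy N ε γ z x else 0)) = 0 := by
    refine Finset.sum_eq_zero fun x hx => ?_
    rw [Finset.mem_filter, Finset.mem_Icc, Fin.le_def, Fin.le_def] at hx
    obtain ⟨-, hx⟩ := hx
    have hle : a₁.val ≤ a₂.val := h
    split_ifs <;> first | (exfalso; omega) | ring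
  rw [h2, add_zero]
  refine Finset.sum_congr rfl fun x hx => ?_
  rw [Finset.mem_Icc, Fin.le_def, Fin.le_def] at hx
  rw [if_pos hx.1, if_neg (by omega), sub_zero]

/-- A sum over the (at most one) site `x = y + 1`. [folklore] -/
theorem sum_ite_eq_succ (y : Fin N) (c : ℝ) :
    ∑ x : Fin N, (if x.val = y.val + 1 then c else 0) = if y.val + 1 < N then c else 0 := by
  by_cases h : y.val + 1 < N
  · rw [if_pos h, Finset.sum_eq_single_of_mem (⟨y.val + 1, h⟩ : Fin N) (Finset.mem_univ _)
      (fun x _ hx => if_neg fun e => hx (Fin.ext e))]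
    simp
  · rw [if_neg h]
    exact Finset.sum_eq_zero fun x _ => if_neg (by have := x.isLt; omega)

/-- **Energy balance of a tail**: `d/dt ∑_{x ≥ m} H_x(Φ_t z) = ε J_{m-1,m}(Φ_t z)` (the interior
currents telescope). [cite: DeRoeckHuveneers2015, §2.2 eq. (2.5)] -/
theorem IsFlow.hasDerivAt_tailEnergy (hΦ : IsFlow N ε γ Φ) (m : ℕ) (z : PhaseSpace N) (t : ℝ) :
    HasDerivAt (fun s => tailEnergy N ε γ m (Φ s z)) (ε * tailCurrent N m (Φ t z)) t := by
  unfold tailEnergy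
  have h : ∀ x : Fin N, HasDerivAt (fun s => if m ≤ x.val then siteEnergy N ε γ (Φ s z) x else 0)
      (if m ≤ x.val then ε * (inCurrent N x (Φ t z) - bondCurrent N x (Φ t z)) else 0) t := fun x => by
    by_cases hx : m ≤ x.val
    · simp only [hx, if_true]; exact hΦ.hasDerivAt_siteEnergy z x t
    · simp only [hx, if_false]; exact hasDerivAt_const _ _
  refine (HasDerivAt.fun_sum fun x _ => h x).congr_deriv ?_
  -- telescoping
  set w := Φ t z
  have hb : ∀ y : Fin N, N ≤ y.val + 1 → bondCurrent N y w = 0 := fun y hy => bondCurrent_eq_zero_of_le y hy w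
  simp_rw [inCurrent_eq_sum_bondCurrent]
  have e1 : ∀ x : Fin N, (if m ≤ x.val then
      ε * (∑ y : Fin N, (if x.val = y.val + 1 then bondCurrent N y w else 0) - bondCurrent N x w) else 0) =
      ε * (∑ y : Fin N, (if m ≤ x.val ∧ x.val = y.val + 1 then bondCurrent N y w else 0) -
        (if m ≤ x.val then bondCurrent N x w else 0)) := by
    intro x
    by_cases hx : m ≤ x.val
    · simp only [hx, if_true, true_and]
    · simp only [hx, if_false, false_and]
      simp
  simp_rw [e1]
  rw [← Finset.mul_sum, Finset.sum_sub_distrib, Finset.sum_comm]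
  unfold tailCurrent
  congr 1
  rw [← Finset.sum_sub_distrib]
  refine Finset.sum_congr rfl fun y _ => ?_
  have e2 : ∀ x : Fin N, (if m ≤ x.val ∧ x.val = y.val + 1 then bondCurrent N y w else 0) =
      (if x.val = y.val + 1 then (if m ≤ y.val + 1 then bondCurrent N y w else 0) else 0) := by
    intro x; split_ifs <;> first | (exfalso; omega) | rfl
  simp_rw [e2]
  rw [sum_ite_eq_succ]
  by_cases hy : y.val + 1 < N
  · rw [if_pos hy]
    split_ifs <;> first | (exfalso; omega) | ring
  · rw [if_neg hy, hb y (by omega)]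
    simp

/-- **Integrated energy balance of an interval**:
`H_I(Φ_t z) - H_I(z) = ε ∫₀ᵗ (J_{a₁-1,a₁} - J_{a₂,a₂+1})(Φ_s z) ds`, `I = {a₁, …, a₂}`.
[cite: DeRoeckHuveneers2015, §7 proof of Thm 4] -/
theorem IsFlow.intervalEnergy_sub_eq (hΦ : IsFlow N ε γ Φ) {a₁ a₂ : Fin N} (h : a₁ ≤ a₂)
    (z : PhaseSpace N) (t : ℝ) :
    intervalEnergy N ε γ a₁ a₂ (Φ t z) - intervalEnergy N ε γ a₁ a₂ z =
      ε * (∫ s in (0 : ℝ)..t, tailCurrent N a₁.val (Φ s z)) -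
        ε * (∫ s in (0 : ℝ)..t, tailCurrent N (a₂.val + 1) (Φ s z)) := by
  have hcont : ∀ m : ℕ, Continuous fun s => ε * tailCurrent N m (Φ s z) := fun m => by
    refine continuous_const.mul ?_
    unfold tailCurrent bondCurrent
    refine continuous_finsetSum _ fun y _ => ?_
    split_ifs
    · refine continuous_finsetSum _ fun x _ => ?_
      split_ifs
      · exact (((continuous_apply x).comp (continuous_snd.comp (hΦ.continuous_orbit z))).mul
          (Real.continuous_sin.comp
            (((continuous_apply y).comp (continuous_fst.comp (hΦ.continuous_orbit z))).sub
            ((continuous_apply x).comp (continuous_fst.comp (hΦ.continuous_orbit z))))))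
      · exact continuous_const
    · exact continuous_const
  have hint : ∀ m : ℕ, (∫ s in (0 : ℝ)..t, ε * tailCurrent N m (Φ s z)) =
      tailEnergy N ε γ m (Φ t z) - tailEnergy N ε γ m z := fun m => by
    rw [intervalIntegral.integral_eq_sub_of_hasDerivAt (fun s _ => hΦ.hasDerivAt_tailEnergy m z s)
      ((hcont m).intervalIntegrable _ _), hΦ.map_zero]
  rw [intervalEnergy_eq_tailEnergy_sub h, intervalEnergy_eq_tailEnergy_sub h,
    ← intervalIntegral.integral_const_mul, ← intervalIntegral.integral_const_mul, hint, hint]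
  ring

/-- The current into the tail `{x ≥ a + 1}` is the bond current `J_{a,a+1}`. [folklore] -/
theorem tailCurrent_succ (a : Fin N) (z : PhaseSpace N) :
    tailCurrent N (a.val + 1) z = bondCurrent N a z := by
  unfold tailCurrent
  rw [Finset.sum_eq_single_of_mem a (Finset.mem_univ _) (fun y _ hy => if_neg fun e =>
    hy (Fin.ext (by omega)))]
  simp

/-- If no site `y` has `y + 1 = m`, the current into the tail `{x ≥ m}` vanishes. [folklore] -/
theorem tailCurrent_eq_zero {m : ℕ} (hm : ∀ y : Fin N, y.val + 1 ≠ m) (z : PhaseSpace N) :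
    tailCurrent N m z = 0 :=
  Finset.sum_eq_zero fun y _ => if_neg (hm y)

/-! ## Liouville's theorem for the rotor chain (symplectic Euler splitting) -/

section Liouville

open Metric

/-! ### The force as a map of configurations -/

/-- The force is continuous as a map `ℝ^N → ℝ^N`. [folklore] -/
theorem continuous_force (N : ℕ) (ε γ : ℝ) : Continuous fun q : Fin N → ℝ => force N ε γ q := by
  refine continuous_pi fun x => ?_
  show Continuous fun q : Fin N → ℝ => -(ε * forceCore N γ q x)
  exact (continuous_const.mul (contDiff_forceCore N γ x (n := 0)).continuous).neg

/-- `‖X_H(z)‖ ≤ ‖z‖ + |ε|(|γ| + 2)`. [folklore] -/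
theorem norm_field_le (ε γ : ℝ) (z : PhaseSpace N) : ‖field N ε γ z‖ ≤ ‖z‖ + |ε| * (|γ| + 2) := by
  rw [Prod.norm_def]
  refine max_le ?_ ?_
  · calc ‖(field N ε γ z).1‖ = ‖z.2‖ := rfl
      _ ≤ ‖z‖ := norm_snd_le z
      _ ≤ ‖z‖ + |ε| * (|γ| + 2) := le_add_of_nonneg_right (by positivity)
  · calc ‖(field N ε γ z).2‖ = ‖force N ε γ z.1‖ := rfl
      _ ≤ |ε| * (|γ| + 2) := norm_force_le ε γ z.1
      _ ≤ ‖z‖ + |ε| * (|γ| + 2) := le_add_of_nonneg_left (norm_nonneg _)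

/-! ### Symplectic Euler: the flow as a limit of compositions of shears -/

/-- The drift shear `(q, ω) ↦ (q + hω, ω)`. [folklore] -/
def driftStep (h : ℝ) (z : PhaseSpace N) : PhaseSpace N := (z.1 + h • z.2, z.2)

/-- The kick shear `(q, ω) ↦ (q, ω + h F(q))`. [folklore] -/
def kickStep (N : ℕ) (ε γ h : ℝ) (z : PhaseSpace N) : PhaseSpace N := (z.1, z.2 + h • force N ε γ z.1)

/-- One step of the symplectic Euler scheme: drift, then kick. [folklore] -/
def eulerStep (N : ℕ) (ε γ h : ℝ) (z : PhaseSpace N) : PhaseSpace N := kickStep N ε γ h (driftStep h z)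

/-- The drift shear preserves phase-space volume (Fubini and translation invariance). [folklore] -/
theorem measurePreserving_driftStep (h : ℝ) :
    MeasurePreserving (driftStep (N := N) h) (volume : Measure (PhaseSpace N)) volume := by
  have e : (driftStep (N := N) h) = Prod.swap ∘
      (fun w : (Fin N → ℝ) × (Fin N → ℝ) => (w.1, w.2 + h • w.1)) ∘ Prod.swap := by
    funext z; rfl
  rw [e]
  have hsk : MeasurePreserving (fun w : (Fin N → ℝ) × (Fin N → ℝ) => (w.1, w.2 + h • w.1))
      ((volume : Measure (Fin N → ℝ)).prod volume) ((volume : Measure (Fin N → ℝ)).prod volume) := by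
    refine MeasurePreserving.skew_product (f := id) (g := fun p q => q + h • p) (MeasurePreserving.id volume)
      (measurable_snd.add (measurable_fst.const_smul h)) (ae_of_all _ fun p => ?_)
    exact (measurePreserving_add_right volume (h • p)).map_eq
  exact ((Measure.measurePreserving_swap (μ := (volume : Measure (Fin N → ℝ))) (ν := volume)).comp hsk).comp
    (Measure.measurePreserving_swap (μ := (volume : Measure (Fin N → ℝ))) (ν := volume))

/-- The kick shear preserves phase-space volume. [folklore] -/
theorem measurePreserving_kickStep (ε γ h : ℝ) :
    MeasurePreserving (kickStep N ε γ h) (volume : Measure (PhaseSpace N)) volume := by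
  refine MeasurePreserving.skew_product (f := id) (g := fun q w => w + h • force N ε γ q)
    (MeasurePreserving.id volume)
    (measurable_snd.add (((continuous_force N ε γ).measurable.comp measurable_fst).const_smul h))
    (ae_of_all _ fun q => ?_)
  exact (measurePreserving_add_right volume (h • force N ε γ q)).map_eq

/-- One symplectic Euler step preserves phase-space volume. [folklore] -/
theorem measurePreserving_eulerStep (ε γ h : ℝ) :
    MeasurePreserving (eulerStep N ε γ h) (volume : Measure (PhaseSpace N)) volume :=
  (measurePreserving_kickStep ε γ h).comp (measurePreserving_driftStep h)

/-- The symplectic Euler step is `z + hX_H(z)` up to `O(h²‖z‖)`. [folklore] -/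
theorem eulerStep_eq (ε γ h : ℝ) (z : PhaseSpace N) :
    eulerStep N ε γ h z = z + h • field N ε γ z +
      ((0 : Fin N → ℝ), h • (force N ε γ (z.1 + h • z.2) - force N ε γ z.1)) := by
  ext x
  · simp [eulerStep, kickStep, driftStep, field]
  · simp [eulerStep, kickStep, driftStep, field]; ring

/-- The remainder of the symplectic Euler step: `‖step_h(z) - z - hX_H(z)‖ ≤ |ε|(|γ|+4) h² ‖z‖`.
[folklore] -/
theorem norm_eulerStep_sub_le (ε γ h : ℝ) (z : PhaseSpace N) :
    ‖eulerStep N ε γ h z - z - h • field N ε γ z‖ ≤ |ε| * (|γ| + 4) * h ^ 2 * ‖z‖ := by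
  rw [eulerStep_eq, show z + h • field N ε γ z +
      ((0 : Fin N → ℝ), h • (force N ε γ (z.1 + h • z.2) - force N ε γ z.1)) - z - h • field N ε γ z =
      ((0 : Fin N → ℝ), h • (force N ε γ (z.1 + h • z.2) - force N ε γ z.1)) by abel]
  rw [Prod.norm_def, norm_zero, max_eq_right (norm_nonneg _), norm_smul, Real.norm_eq_abs]
  calc |h| * ‖force N ε γ (z.1 + h • z.2) - force N ε γ z.1‖
      ≤ |h| * (|ε| * (|γ| + 4) * ‖(z.1 + h • z.2) - z.1‖) :=
        mul_le_mul_of_nonneg_left (norm_force_sub_force_le ε γ _ _) (abs_nonneg h)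
    _ = |h| * (|ε| * (|γ| + 4) * (|h| * ‖z.2‖)) := by
        rw [add_sub_cancel_left, norm_smul, Real.norm_eq_abs]
    _ ≤ |h| * (|ε| * (|γ| + 4) * (|h| * ‖z‖)) := by gcongr; exact norm_snd_le z
    _ = |ε| * (|γ| + 4) * (|h| * |h|) * ‖z‖ := by ring
    _ = |ε| * (|γ| + 4) * h ^ 2 * ‖z‖ := by rw [abs_mul_abs_self, sq]

/-- The symplectic Euler step is Lipschitz with constant `(1 + |h|)(1 + |h| |ε|(|γ|+4))`. [folklore] -/
theorem norm_eulerStep_sub_eulerStep_le (ε γ h : ℝ) (z z' : PhaseSpace N) :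
    ‖eulerStep N ε γ h z - eulerStep N ε γ h z'‖ ≤
      (1 + |h|) * (1 + |h| * (|ε| * (|γ| + 4))) * ‖z - z'‖ := by
  set L := |ε| * (|γ| + 4) with hL
  have hL0 : 0 ≤ L := by positivity
  -- drift
  have hd : ‖driftStep h z - driftStep h z'‖ ≤ (1 + |h|) * ‖z - z'‖ := by
    rw [Prod.norm_def]
    refine max_le ?_ ?_
    · calc ‖(driftStep h z - driftStep h z').1‖ = ‖(z.1 - z'.1) + h • (z.2 - z'.2)‖ := by
            congr 1; simp only [driftStep, Prod.fst_sub, smul_sub]; abel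
        _ ≤ ‖z.1 - z'.1‖ + ‖h • (z.2 - z'.2)‖ := norm_add_le _ _
        _ ≤ ‖z - z'‖ + |h| * ‖z - z'‖ := by
            rw [norm_smul, Real.norm_eq_abs]
            exact add_le_add (norm_fst_le (z - z')) (mul_le_mul_of_nonneg_left (norm_snd_le (z - z')) (abs_nonneg h))
        _ = (1 + |h|) * ‖z - z'‖ := by ring
    · calc ‖(driftStep h z - driftStep h z').2‖ = ‖(z - z').2‖ := by simp [driftStep]
        _ ≤ ‖z - z'‖ := norm_snd_le _
        _ ≤ (1 + |h|) * ‖z - z'‖ := le_mul_of_one_le_left (norm_nonneg _) (by linarith [abs_nonneg h])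
  -- kick
  have hk : ∀ w w' : PhaseSpace N, ‖kickStep N ε γ h w - kickStep N ε γ h w'‖ ≤ (1 + |h| * L) * ‖w - w'‖ := by
    intro w w'
    rw [Prod.norm_def]
    refine max_le ?_ ?_
    · calc ‖(kickStep N ε γ h w - kickStep N ε γ h w').1‖ = ‖(w - w').1‖ := by simp [kickStep]
        _ ≤ ‖w - w'‖ := norm_fst_le _
        _ ≤ (1 + |h| * L) * ‖w - w'‖ := le_mul_of_one_le_left (norm_nonneg _) (by nlinarith [abs_nonneg h])
    · calc ‖(kickStep N ε γ h w - kickStep N ε γ h w').2‖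
            = ‖(w.2 - w'.2) + h • (force N ε γ w.1 - force N ε γ w'.1)‖ := by
              congr 1; simp only [kickStep, Prod.snd_sub, smul_sub]; abel
        _ ≤ ‖w.2 - w'.2‖ + ‖h • (force N ε γ w.1 - force N ε γ w'.1)‖ := norm_add_le _ _
        _ ≤ ‖w - w'‖ + |h| * (L * ‖w.1 - w'.1‖) := by
              rw [norm_smul, Real.norm_eq_abs]
              exact add_le_add (norm_snd_le (w - w'))
                (mul_le_mul_of_nonneg_left (norm_force_sub_force_le ε γ _ _) (abs_nonneg h))
        _ ≤ ‖w - w'‖ + |h| * (L * ‖w - w'‖) := by gcongr; exact norm_fst_le (w - w')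
        _ = (1 + |h| * L) * ‖w - w'‖ := by ring
  calc ‖eulerStep N ε γ h z - eulerStep N ε γ h z'‖ ≤ (1 + |h| * L) * ‖driftStep h z - driftStep h z'‖ := hk _ _
    _ ≤ (1 + |h| * L) * ((1 + |h|) * ‖z - z'‖) := mul_le_mul_of_nonneg_left hd (by positivity)
    _ = (1 + |h|) * (1 + |h| * L) * ‖z - z'‖ := by ring

/-- Momenta move by at most `|h| |ε|(|γ|+2)` per step: after `k` steps,
`‖ω_k - ω_0‖ ≤ k|h| |ε|(|γ|+2)`. [folklore] -/
theorem norm_snd_iterate_eulerStep_sub_le (ε γ h : ℝ) (z : PhaseSpace N) (k : ℕ) :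
    ‖((eulerStep N ε γ h)^[k] z).2 - z.2‖ ≤ k * |h| * (|ε| * (|γ| + 2)) := by
  induction k with
  | zero => simp
  | succ k ih =>
      rw [Function.iterate_succ_apply']
      set w := (eulerStep N ε γ h)^[k] z
      have hstep : (eulerStep N ε γ h w).2 - w.2 = h • force N ε γ (w.1 + h • w.2) := by
        simp [eulerStep, kickStep, driftStep]
      calc ‖(eulerStep N ε γ h w).2 - z.2‖ = ‖((eulerStep N ε γ h w).2 - w.2) + (w.2 - z.2)‖ := by abel_nf
        _ ≤ ‖(eulerStep N ε γ h w).2 - w.2‖ + ‖w.2 - z.2‖ := norm_add_le _ _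
        _ ≤ |h| * (|ε| * (|γ| + 2)) + k * |h| * (|ε| * (|γ| + 2)) := by
            refine add_le_add ?_ ih
            rw [hstep, norm_smul, Real.norm_eq_abs]
            exact mul_le_mul_of_nonneg_left (norm_force_le ε γ _) (abs_nonneg h)
        _ = ((k + 1 : ℕ) : ℝ) * |h| * (|ε| * (|γ| + 2)) := by push_cast; ring

/-- Angles move by at most `|h| ‖ω‖` per step: after `k` steps,
`‖q_k - q_0‖ ≤ k|h| (‖ω_0‖ + k|h| |ε|(|γ|+2))`. [folklore] -/
theorem norm_fst_iterate_eulerStep_sub_le (ε γ h : ℝ) (z : PhaseSpace N) (k : ℕ) :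
    ‖((eulerStep N ε γ h)^[k] z).1 - z.1‖ ≤ k * |h| * (‖z.2‖ + k * |h| * (|ε| * (|γ| + 2))) := by
  induction k with
  | zero => simp
  | succ k ih =>
      rw [Function.iterate_succ_apply']
      set w := (eulerStep N ε γ h)^[k] z with hw
      have hB : 0 ≤ |ε| * (|γ| + 2) := by positivity
      have hw2 : ‖w.2‖ ≤ ‖z.2‖ + k * |h| * (|ε| * (|γ| + 2)) := by
        have := norm_snd_iterate_eulerStep_sub_le ε γ h z k
        rw [← hw] at this
        calc ‖w.2‖ = ‖(w.2 - z.2) + z.2‖ := by abel_nf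
          _ ≤ ‖w.2 - z.2‖ + ‖z.2‖ := norm_add_le _ _
          _ ≤ _ := by linarith
      have hstep : (eulerStep N ε γ h w).1 - w.1 = h • w.2 := by
        simp [eulerStep, kickStep, driftStep]
      calc ‖(eulerStep N ε γ h w).1 - z.1‖ = ‖((eulerStep N ε γ h w).1 - w.1) + (w.1 - z.1)‖ := by abel_nf
        _ ≤ ‖(eulerStep N ε γ h w).1 - w.1‖ + ‖w.1 - z.1‖ := norm_add_le _ _
        _ ≤ |h| * (‖z.2‖ + k * |h| * (|ε| * (|γ| + 2))) + k * |h| * (‖z.2‖ + k * |h| * (|ε| * (|γ| + 2))) := by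
            refine add_le_add ?_ ih
            rw [hstep, norm_smul, Real.norm_eq_abs]
            exact mul_le_mul_of_nonneg_left hw2 (abs_nonneg h)
        _ = ((k : ℝ) + 1) * |h| * (‖z.2‖ + k * |h| * (|ε| * (|γ| + 2))) := by ring
        _ ≤ ((k + 1 : ℕ) : ℝ) * |h| * (‖z.2‖ + ((k + 1 : ℕ) : ℝ) * |h| * (|ε| * (|γ| + 2))) := by
            push_cast
            have : 0 ≤ ((k : ℝ) + 1) * |h| := by positivity
            have h2 : (k : ℝ) * |h| * (|ε| * (|γ| + 2)) ≤ ((k : ℝ) + 1) * |h| * (|ε| * (|γ| + 2)) := by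
              refine mul_le_mul_of_nonneg_right ?_ hB
              exact mul_le_mul_of_nonneg_right (by linarith) (abs_nonneg h)
            exact mul_le_mul_of_nonneg_left (by linarith) this

/-- **Backward confinement of the scheme**: if after `k` steps of size `h`, `k|h| ≤ t`, the point
is in the ball of radius `ρ`, then it started in the ball of radius
`ρ + tB + t(ρ + 2tB)`, `B = |ε|(|γ|+2)`. [folklore] -/
theorem norm_le_of_norm_iterate_eulerStep_le (ε γ h : ℝ) (z : PhaseSpace N) (k : ℕ) {t ρ : ℝ}
    (hkt : k * |h| ≤ t) (hρ : ‖(eulerStep N ε γ h)^[k] z‖ ≤ ρ) :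
    ‖z‖ ≤ ρ + t * (|ε| * (|γ| + 2)) + t * (ρ + 2 * t * (|ε| * (|γ| + 2))) := by
  set B := |ε| * (|γ| + 2) with hBdef
  have hB : 0 ≤ B := by positivity
  have ht : 0 ≤ t := le_trans (by positivity) hkt
  set w := (eulerStep N ε γ h)^[k] z with hw
  have h2 := norm_snd_iterate_eulerStep_sub_le ε γ h z k
  have h1 := norm_fst_iterate_eulerStep_sub_le ε γ h z k
  rw [← hw] at h1 h2
  have hw1 : ‖w.1‖ ≤ ρ := (norm_fst_le w).trans hρ
  have hw2 : ‖w.2‖ ≤ ρ := (norm_snd_le w).trans hρ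
  have hz2 : ‖z.2‖ ≤ ρ + t * B := by
    calc ‖z.2‖ = ‖w.2 - (w.2 - z.2)‖ := by abel_nf
      _ ≤ ‖w.2‖ + ‖w.2 - z.2‖ := norm_sub_le _ _
      _ ≤ ρ + k * |h| * B := add_le_add hw2 h2
      _ ≤ ρ + t * B := by gcongr
  have hz1 : ‖z.1‖ ≤ ρ + t * (ρ + 2 * t * B) := by
    calc ‖z.1‖ = ‖w.1 - (w.1 - z.1)‖ := by abel_nf
      _ ≤ ‖w.1‖ + ‖w.1 - z.1‖ := norm_sub_le _ _
      _ ≤ ρ + k * |h| * (‖z.2‖ + k * |h| * B) := add_le_add hw1 h1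
      _ ≤ ρ + t * ((ρ + t * B) + t * B) := by gcongr
      _ = ρ + t * (ρ + 2 * t * B) := by ring
  have hρ0 : 0 ≤ ρ := (norm_nonneg _).trans hρ
  have hx : 0 ≤ t * (ρ + 2 * t * B) := mul_nonneg ht (by positivity)
  have hy : 0 ≤ t * B := mul_nonneg ht hB
  rw [Prod.norm_def]
  refine max_le (hz1.trans ?_) (hz2.trans ?_)
  · linarith
  · linarith

/-- **Consistency of the symplectic Euler scheme along an orbit**: if `‖Φ_u z‖ ≤ R` on `[0, t]`
then for `0 ≤ s ≤ s + h ≤ t`,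
`‖step_h(Φ_s z) - Φ_{s+h} z‖ ≤ (K(R + B) + L R) h²` with `K` the Lipschitz constant of the field,
`B = |ε|(|γ|+2)` its bound at the origin's momenta and `L = |ε|(|γ|+4)`. [folklore] -/
theorem IsFlow.norm_eulerStep_sub_map_le (hΦ : IsFlow N ε γ Φ) (z : PhaseSpace N) {t R : ℝ}
    (hR : ∀ u ∈ Icc 0 t, ‖Φ u z‖ ≤ R) {s h : ℝ} (hs : 0 ≤ s) (hh : 0 ≤ h) (hsh : s + h ≤ t) :
    ‖eulerStep N ε γ h (Φ s z) - Φ (s + h) z‖ ≤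
      ((fieldLipschitz ε γ : ℝ) * (R + |ε| * (|γ| + 2)) + |ε| * (|γ| + 4) * R) * h ^ 2 := by
  set K : ℝ := ((fieldLipschitz ε γ : NNReal) : ℝ) with hKdef
  set B := |ε| * (|γ| + 2)
  set L := |ε| * (|γ| + 4)
  set M := R + B with hM
  have hR0 : 0 ≤ R := (norm_nonneg _).trans (hR 0 ⟨le_rfl, hs.trans (by linarith)⟩)
  -- velocity bound on `[0, t]`
  have hvel : ∀ u ∈ Icc 0 t, ‖field N ε γ (Φ u z)‖ ≤ M := fun u hu =>
    (norm_field_le ε γ _).trans (by simp only [hM]; linarith [hR u hu])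
  -- the orbit is `M`-Lipschitz on `[0, t]`
  have hlip : ∀ u ∈ Icc s (s + h), ‖Φ u z - Φ s z‖ ≤ M * (u - s) := by
    intro u hu
    have hsub : Icc s (s + h) ⊆ Icc 0 t := Icc_subset_Icc hs hsh
    have := (convex_Icc s (s + h)).norm_image_sub_le_of_norm_hasDerivWithin_le (f := fun u => Φ u z)
      (fun x _ => (hΦ.hasDerivAt z x).hasDerivWithinAt) (fun x hx => hvel x (hsub hx))
      (left_mem_Icc.2 (by linarith)) hu
    rwa [Real.norm_eq_abs, abs_of_nonneg (by linarith [hu.1])] at this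
  -- integral form of the flow
  have hint : Φ (s + h) z - Φ s z = ∫ u in s..(s + h), field N ε γ (Φ u z) := by
    rw [intervalIntegral.integral_eq_sub_of_hasDerivAt (fun u _ => hΦ.hasDerivAt z u)
      (((continuous_field N ε γ).comp (hΦ.continuous_orbit z)).intervalIntegrable _ _)]
  -- the integral of the frozen field
  have hconst : (∫ _ in s..(s + h), field N ε γ (Φ s z)) = h • field N ε γ (Φ s z) := by
    rw [intervalIntegral.integral_const]; simp
  have hdiff : ‖(∫ u in s..(s + h), field N ε γ (Φ u z)) - h • field N ε γ (Φ s z)‖ ≤ K * M * h * h := by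
    have i1 : IntervalIntegrable (fun u => field N ε γ (Φ u z)) volume s (s + h) :=
      ((continuous_field N ε γ).comp (hΦ.continuous_orbit z)).intervalIntegrable _ _
    have i2 : IntervalIntegrable (fun _ => field N ε γ (Φ s z)) volume s (s + h) :=
      intervalIntegrable_const
    rw [← hconst, ← intervalIntegral.integral_sub i1 i2]
    have hb : ∀ u ∈ Set.uIoc s (s + h), ‖field N ε γ (Φ u z) - field N ε γ (Φ s z)‖ ≤ K * M * h := by
      intro u hu
      rw [uIoc_of_le (by linarith)] at hu
      calc ‖field N ε γ (Φ u z) - field N ε γ (Φ s z)‖ ≤ K * ‖Φ u z - Φ s z‖ :=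
            (lipschitzWith_field N ε γ).norm_sub_le _ _
        _ ≤ K * (M * (u - s)) := mul_le_mul_of_nonneg_left (hlip u ⟨hu.1.le, hu.2⟩) (by positivity)
        _ ≤ K * (M * h) := by
            refine mul_le_mul_of_nonneg_left (mul_le_mul_of_nonneg_left (by linarith [hu.2]) ?_) (by positivity)
            simp only [hM]; positivity
        _ = K * M * h := by ring
    calc _ ≤ K * M * h * |s + h - s| := intervalIntegral.norm_integral_le_of_norm_le_const hb
      _ = K * M * h * h := by rw [add_sub_cancel_left, abs_of_nonneg hh]
  -- the remainder of the step
  have hrem := norm_eulerStep_sub_le ε γ h (Φ s z)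
  have hzs : ‖Φ s z‖ ≤ R := hR s ⟨hs, by linarith⟩
  calc ‖eulerStep N ε γ h (Φ s z) - Φ (s + h) z‖
      = ‖(eulerStep N ε γ h (Φ s z) - Φ s z - h • field N ε γ (Φ s z)) -
          ((∫ u in s..(s + h), field N ε γ (Φ u z)) - h • field N ε γ (Φ s z))‖ := by
        rw [← hint]; congr 1; abel
    _ ≤ ‖eulerStep N ε γ h (Φ s z) - Φ s z - h • field N ε γ (Φ s z)‖ +
          ‖(∫ u in s..(s + h), field N ε γ (Φ u z)) - h • field N ε γ (Φ s z)‖ := norm_sub_le _ _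
    _ ≤ L * h ^ 2 * ‖Φ s z‖ + K * M * h * h := add_le_add hrem hdiff
    _ ≤ L * h ^ 2 * R + K * M * h * h := by gcongr
    _ = (K * (R + B) + L * R) * h ^ 2 := by simp only [hM]; ring

/-- **Convergence of the symplectic Euler scheme to the flow**: for `t ≥ 0`,
`step_{t/(m+1)}^{m+1}(z) → Φ_t z` as `m → ∞`. [folklore] -/
theorem IsFlow.tendsto_iterate_eulerStep (hΦ : IsFlow N ε γ Φ) (z : PhaseSpace N) {t : ℝ} (ht : 0 ≤ t) :
    Tendsto (fun m : ℕ => (eulerStep N ε γ (t / (m + 1)))^[m + 1] z) atTop (𝓝 (Φ t z)) := by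
  -- a priori bound of the orbit on `[0, t]`
  obtain ⟨R, hR⟩ := (isCompact_Icc (a := (0 : ℝ)) (b := t)).exists_bound_of_continuousOn
    ((hΦ.continuous_orbit z).continuousOn)
  set K : ℝ := ((fieldLipschitz ε γ : NNReal) : ℝ)
  set B := |ε| * (|γ| + 2)
  set L := |ε| * (|γ| + 4)
  set C := K * (R + B) + L * R with hC
  have hK0 : 0 ≤ K := NNReal.coe_nonneg _
  have hL0 : 0 ≤ L := by positivity
  have hR0 : 0 ≤ R := (norm_nonneg _).trans (hR 0 ⟨le_rfl, ht⟩)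
  have hC0 : 0 ≤ C := by positivity
  -- error bound after `k ≤ m + 1` steps of size `h = t/(m+1)`
  have herr : ∀ (m k : ℕ), k ≤ m + 1 →
      ‖(eulerStep N ε γ (t / (m + 1)))^[k] z - Φ (k * (t / (m + 1))) z‖ ≤
        k * C * (t / (m + 1)) ^ 2 * Real.exp ((1 + L) * t) := by
    intro m k hk
    set h := t / (m + 1) with hh
    have hm : (0 : ℝ) < m + 1 := by positivity
    have hh0 : 0 ≤ h := div_nonneg ht hm.le
    have hht : (m + 1 : ℝ) * h = t := by rw [hh]; field_simp
    set Λ := (1 + |h|) * (1 + |h| * L) with hΛ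
    have hΛ1 : 1 ≤ Λ := by
      have : 0 ≤ |h| * L := by positivity
      nlinarith [abs_nonneg h]
    have hΛexp : Λ ≤ Real.exp ((1 + L) * h) := by
      rw [hΛ, abs_of_nonneg hh0]
      calc (1 + h) * (1 + h * L) ≤ Real.exp h * Real.exp (h * L) :=
            mul_le_mul (by linarith [Real.add_one_le_exp h]) (by linarith [Real.add_one_le_exp (h * L)])
              (by positivity) (Real.exp_nonneg _)
        _ = Real.exp ((1 + L) * h) := by rw [← Real.exp_add]; congr 1; ring
    -- induction on `k` with the sharper bound `k C h² Λ^k`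
    have key : ∀ k : ℕ, k ≤ m + 1 →
        ‖(eulerStep N ε γ h)^[k] z - Φ (k * h) z‖ ≤ k * C * h ^ 2 * Λ ^ k := by
      intro k
      induction k with
      | zero => intro _; simp [hΦ.map_zero]
      | succ k ih =>
          intro hk1
          have hk : k ≤ m + 1 := Nat.le_of_succ_le hk1
          have hkh : (k : ℝ) * h + h ≤ t := by
            calc (k : ℝ) * h + h = ((k : ℝ) + 1) * h := by ring
              _ ≤ (m + 1 : ℝ) * h := by
                  refine mul_le_mul_of_nonneg_right ?_ hh0
                  exact_mod_cast hk1
              _ = t := hht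
          rw [Function.iterate_succ_apply']
          set w := (eulerStep N ε γ h)^[k] z
          have e : ((k + 1 : ℕ) : ℝ) * h = k * h + h := by push_cast; ring
          rw [e]
          calc ‖eulerStep N ε γ h w - Φ (k * h + h) z‖
              = ‖(eulerStep N ε γ h w - eulerStep N ε γ h (Φ (k * h) z)) +
                  (eulerStep N ε γ h (Φ (k * h) z) - Φ (k * h + h) z)‖ := by abel_nf
            _ ≤ ‖eulerStep N ε γ h w - eulerStep N ε γ h (Φ (k * h) z)‖ +
                  ‖eulerStep N ε γ h (Φ (k * h) z) - Φ (k * h + h) z‖ := norm_add_le _ _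
            _ ≤ Λ * ‖w - Φ (k * h) z‖ + C * h ^ 2 := by
                refine add_le_add (norm_eulerStep_sub_eulerStep_le ε γ h _ _) ?_
                exact hΦ.norm_eulerStep_sub_map_le z hR (by positivity) hh0 hkh
            _ ≤ Λ * (k * C * h ^ 2 * Λ ^ k) + C * h ^ 2 * Λ ^ (k + 1) := by
                refine add_le_add (mul_le_mul_of_nonneg_left (ih hk) (by linarith)) ?_
                exact le_mul_of_one_le_right (by positivity) (one_le_pow₀ hΛ1)
            _ = ((k + 1 : ℕ) : ℝ) * C * h ^ 2 * Λ ^ (k + 1) := by push_cast; ring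
    refine (key k hk).trans ?_
    have hΛk : Λ ^ k ≤ Real.exp ((1 + L) * t) := by
      calc Λ ^ k ≤ Λ ^ (m + 1) := pow_le_pow_right₀ hΛ1 hk
        _ ≤ (Real.exp ((1 + L) * h)) ^ (m + 1) := pow_le_pow_left₀ (by linarith) hΛexp _
        _ = Real.exp ((1 + L) * t) := by
            rw [← Real.exp_nat_mul]; congr 1; push_cast; rw [← hht]; ring
    exact mul_le_mul_of_nonneg_left hΛk (by positivity)
  -- conclude
  rw [tendsto_iff_norm_sub_tendsto_zero]
  have hbound : ∀ m : ℕ, ‖(eulerStep N ε γ (t / (m + 1)))^[m + 1] z - Φ t z‖ ≤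
      (C * t ^ 2 * Real.exp ((1 + L) * t)) / ((m : ℝ) + 1) := by
    intro m
    have hm : (0 : ℝ) < m + 1 := by positivity
    have := herr m (m + 1) le_rfl
    have e : ((m + 1 : ℕ) : ℝ) * (t / (m + 1)) = t := by push_cast; field_simp
    rw [e] at this
    refine this.trans (le_of_eq ?_)
    push_cast
    field_simp
  refine squeeze_zero (fun m => norm_nonneg _) hbound ?_
  exact tendsto_const_nhds.div_atTop (tendsto_atTop_add_const_right _ _ tendsto_natCast_atTop_atTop)

/-! ### From the scheme to Liouville's theorem -/

/-- **Volume invariance tested on `C_c`**: for `t ≥ 0` and a continuous compactly supported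
`g ≥ 0`, `∫ g ∘ Φ_t dvol = ∫ g dvol` (the scheme preserves volume exactly; dominated convergence).
[cite: Arnold1989, §16 Thm 1] -/
theorem IsFlow.lintegral_comp_eq_of_hasCompactSupport (hΦ : IsFlow N ε γ Φ) {t : ℝ} (ht : 0 ≤ t)
    {g : PhaseSpace N → ℝ} (hg : Continuous g) (hgs : HasCompactSupport g) :
    ∫⁻ z, ENNReal.ofReal (g (Φ t z)) = ∫⁻ z, ENNReal.ofReal (g z) := by
  -- a ball containing the support, a bound for `g`
  obtain ⟨ρ, hρ⟩ := hgs.isCompact.isBounded.subset_closedBall 0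
  obtain ⟨Cg, hCg⟩ := hgs.exists_bound_of_continuous hg
  set B := |ε| * (|γ| + 2)
  set ρ' := |ρ| + t * B + t * (|ρ| + 2 * t * B) with hρ'
  -- the approximants
  set F : ℕ → PhaseSpace N → ℝ≥0∞ := fun m z =>
    ENNReal.ofReal (g ((eulerStep N ε γ (t / (m + 1)))^[m + 1] z)) with hF
  have hgm : Measurable fun z => ENNReal.ofReal (g z) := ENNReal.measurable_ofReal.comp hg.measurable
  have hFm : ∀ m, Measurable (F m) := fun m =>
    hgm.comp ((measurePreserving_eulerStep ε γ (t / (m + 1))).iterate (m + 1)).measurable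
  have hFint : ∀ m, ∫⁻ z, F m z = ∫⁻ z, ENNReal.ofReal (g z) := fun m =>
    ((measurePreserving_eulerStep ε γ (t / (m + 1))).iterate (m + 1)).lintegral_comp hgm
  -- domination by a constant on a big ball
  set bound : PhaseSpace N → ℝ≥0∞ := (closedBall (0 : PhaseSpace N) ρ').indicator fun _ => ENNReal.ofReal Cg
    with hbound_def
  have hbound : ∀ m, F m ≤ᵐ[volume] bound := fun m => ae_of_all _ fun z => by
    simp only [hF]
    by_cases hz : g ((eulerStep N ε γ (t / (m + 1)))^[m + 1] z) = 0
    · rw [hz, ENNReal.ofReal_zero]; exact bot_le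
    · have hsupp : (eulerStep N ε γ (t / (m + 1)))^[m + 1] z ∈ closedBall (0 : PhaseSpace N) ρ :=
        hρ (subset_tsupport _ (Function.mem_support.2 hz))
      have hnorm : ‖(eulerStep N ε γ (t / (m + 1)))^[m + 1] z‖ ≤ |ρ| :=
        (mem_closedBall_zero_iff.1 hsupp).trans (le_abs_self ρ)
      have hkt : ((m + 1 : ℕ) : ℝ) * |t / (m + 1)| ≤ t := by
        have e : ((m + 1 : ℕ) : ℝ) * (t / (m + 1)) = t := by push_cast; field_simp
        rw [abs_of_nonneg (div_nonneg ht (by positivity)), e]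
      have hz' : z ∈ closedBall (0 : PhaseSpace N) ρ' := by
        rw [mem_closedBall_zero_iff, hρ']
        exact norm_le_of_norm_iterate_eulerStep_le ε γ _ z (m + 1) hkt hnorm
      rw [hbound_def, Set.indicator_of_mem hz']
      exact ENNReal.ofReal_le_ofReal ((le_abs_self _).trans ((Real.norm_eq_abs _).symm.trans_le (hCg _)))
  have hfin : ∫⁻ z, bound z ≠ ⊤ := by
    haveI := isAddHaarMeasure_volume_phaseSpace N
    rw [hbound_def, lintegral_indicator measurableSet_closedBall, setLIntegral_const]
    exact ENNReal.mul_ne_top ENNReal.ofReal_ne_top (measure_closedBall_lt_top).ne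
  have hlim : ∀ᵐ z ∂(volume : Measure (PhaseSpace N)),
      Tendsto (fun m => F m z) atTop (𝓝 (ENNReal.ofReal (g (Φ t z)))) := ae_of_all _ fun z =>
    ((ENNReal.continuous_ofReal.comp hg).tendsto _).comp (hΦ.tendsto_iterate_eulerStep z ht)
  have hconv := tendsto_lintegral_of_dominated_convergence bound hFm hbound hfin hlim
  simp_rw [hFint] at hconv
  exact tendsto_nhds_unique hconv tendsto_const_nhds

/-- **Volume invariance on bounded open sets** (`t ≥ 0`): `vol(Φ_t⁻¹ O) = vol(O)`, by monotone
approximation of `1_O` by continuous compactly supported functions. [cite: Arnold1989, §16 Thm 1] -/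
theorem IsFlow.volume_preimage_eq_of_isOpen (hΦ : IsFlow N ε γ Φ) {t : ℝ} (ht : 0 ≤ t)
    {O : Set (PhaseSpace N)} (hO : IsOpen O) (hOb : Bornology.IsBounded O) :
    volume (Φ t ⁻¹' O) = volume O := by
  by_cases hOc : Oᶜ = ∅
  · have : O = univ := compl_empty_iff.1 hOc
    subst this
    simp
  have hne : (Oᶜ).Nonempty := nonempty_iff_ne_empty.2 hOc
  -- the approximants `g_n = min(1, n · dist(·, Oᶜ))`
  set g : ℕ → PhaseSpace N → ℝ := fun n z => min 1 (n * infDist z Oᶜ) with hgdef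
  have hgc : ∀ n, Continuous (g n) := fun n =>
    continuous_const.min (continuous_const.mul (continuous_infDist_pt (Oᶜ)))
  have hg0 : ∀ n z, 0 ≤ g n z := fun n z => le_min zero_le_one (mul_nonneg (Nat.cast_nonneg n) infDist_nonneg)
  have hgO : ∀ n z, z ∉ O → g n z = 0 := fun n z hz => by
    simp only [hgdef, infDist_zero_of_mem (mem_compl hz), mul_zero]
    exact min_eq_right zero_le_one
  have hgs : ∀ n, HasCompactSupport (g n) := fun n =>
    HasCompactSupport.intro hOb.isCompact_closure fun z hz => hgO n z fun h => hz (subset_closure h)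
  have hmono : Monotone fun n z => ENNReal.ofReal (g n z) := by
    intro n n' hnn' z
    refine ENNReal.ofReal_le_ofReal (min_le_min le_rfl ?_)
    exact mul_le_mul_of_nonneg_right (by exact_mod_cast hnn') infDist_nonneg
  have hsup : ∀ z, (⨆ n, ENNReal.ofReal (g n z)) = O.indicator 1 z := by
    intro z
    by_cases hz : z ∈ O
    · rw [Set.indicator_of_mem hz, Pi.one_apply]
      have hpos : 0 < infDist z Oᶜ := (hO.isClosed_compl.notMem_iff_infDist_pos hne).1
        (fun h => h hz)
      obtain ⟨n, hn⟩ := exists_nat_ge (1 / infDist z Oᶜ)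
      apply le_antisymm
      · exact iSup_le fun n => by
          rw [← ENNReal.ofReal_one]; exact ENNReal.ofReal_le_ofReal (min_le_left _ _)
      · refine le_iSup_of_le n ?_
        have h1 : 1 ≤ (n : ℝ) * infDist z Oᶜ := (div_le_iff₀ hpos).1 hn
        rw [show g n z = 1 from min_eq_left h1, ENNReal.ofReal_one]
    · rw [Set.indicator_of_notMem hz]
      simp [hgO _ z hz]
  have hsup' : ∀ z, (⨆ n, ENNReal.ofReal (g n (Φ t z))) = (Φ t ⁻¹' O).indicator 1 z := fun z => by
    rw [hsup (Φ t z)]; rfl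
  calc volume (Φ t ⁻¹' O) = ∫⁻ z, (Φ t ⁻¹' O).indicator 1 z :=
        (lintegral_indicator_one (hO.measurableSet.preimage (hΦ.measurable t))).symm
    _ = ∫⁻ z, ⨆ n, ENNReal.ofReal (g n (Φ t z)) := by simp_rw [hsup']
    _ = ⨆ n, ∫⁻ z, ENNReal.ofReal (g n (Φ t z)) :=
        lintegral_iSup (fun n => (ENNReal.measurable_ofReal.comp (hgc n).measurable).comp (hΦ.measurable t))
          (fun n n' h z => hmono h (Φ t z))
    _ = ⨆ n, ∫⁻ z, ENNReal.ofReal (g n z) := by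
        simp_rw [hΦ.lintegral_comp_eq_of_hasCompactSupport ht (hgc _) (hgs _)]
    _ = ∫⁻ z, ⨆ n, ENNReal.ofReal (g n z) :=
        (lintegral_iSup (fun n => ENNReal.measurable_ofReal.comp (hgc n).measurable) hmono).symm
    _ = ∫⁻ z, O.indicator 1 z := by simp_rw [hsup]
    _ = volume O := lintegral_indicator_one hO.measurableSet

/-- A Borel measure on phase space that agrees with Lebesgue measure on the bounded open sets is
Lebesgue measure (the bounded open sets form a π-system generating the Borel σ-algebra and
exhausting the space by balls of finite volume). [folklore] -/
theorem measure_eq_volume_of_isOpen {ν : Measure (PhaseSpace N)}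
    (h : ∀ O : Set (PhaseSpace N), IsOpen O → Bornology.IsBounded O → ν O = volume O) :
    ν = volume := by
  haveI := isAddHaarMeasure_volume_phaseSpace N
  symm
  refine Measure.ext_of_generateFrom_of_iUnion
    {O : Set (PhaseSpace N) | IsOpen O ∧ Bornology.IsBounded O}
    (fun n : ℕ => ball (0 : PhaseSpace N) (n + 1)) ?_ ?_ ?_ ?_ ?_ ?_
  · -- the bounded open sets generate the Borel σ-algebra
    refine (BorelSpace.measurable_eq (α := PhaseSpace N)).trans (le_antisymm ?_ ?_)
    · show MeasurableSpace.generateFrom {s : Set (PhaseSpace N) | IsOpen s} ≤ _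
      refine MeasurableSpace.generateFrom_le fun U (hU : IsOpen U) => ?_
      have hU' : U = ⋃ n : ℕ, U ∩ ball (0 : PhaseSpace N) (n + 1) := by
        ext z
        simp only [mem_iUnion, mem_inter_iff]
        refine ⟨fun hz => ?_, fun ⟨n, hz, _⟩ => hz⟩
        obtain ⟨n, hn⟩ := exists_nat_gt ‖z‖
        exact ⟨n, hz, mem_ball_zero_iff.2 (hn.trans (lt_add_one _))⟩
      rw [hU']
      exact MeasurableSet.iUnion fun n => MeasurableSpace.measurableSet_generateFrom
        ⟨hU.inter isOpen_ball, isBounded_ball.subset inter_subset_right⟩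
    · refine MeasurableSpace.generateFrom_le fun O hO => ?_
      show MeasurableSet[MeasurableSpace.generateFrom {s : Set (PhaseSpace N) | IsOpen s}] O
      exact MeasurableSpace.measurableSet_generateFrom hO.1
  · rintro O ⟨hO, hOb⟩ O' ⟨hO', -⟩ _
    exact ⟨hO.inter hO', hOb.subset inter_subset_left⟩
  · exact iUnion_eq_univ_iff.2 fun z => by
      obtain ⟨n, hn⟩ := exists_nat_gt ‖z‖
      exact ⟨n, mem_ball_zero_iff.2 (hn.trans (lt_add_one _))⟩
  · exact fun n => ⟨isOpen_ball, isBounded_ball⟩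
  · exact fun n => measure_ball_lt_top.ne
  · rintro O ⟨hO, hOb⟩
    exact (h O hO hOb).symm

/-- Volume invariance for `t ≥ 0`. [cite: Arnold1989, §16 Thm 1] -/
theorem IsFlow.measurePreserving_of_nonneg (hΦ : IsFlow N ε γ Φ) {t : ℝ} (ht : 0 ≤ t) :
    MeasurePreserving (Φ t) (volume : Measure (PhaseSpace N)) volume := by
  refine ⟨hΦ.measurable t, measure_eq_volume_of_isOpen fun O hO hOb => ?_⟩
  rw [Measure.map_apply (hΦ.measurable t) hO.measurableSet]
  exact hΦ.volume_preimage_eq_of_isOpen ht hO hOb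

/-- **Liouville's theorem for the rotor chain** (PROVED): every flow map `X^t_ε` of Hamilton's
equations of the rotor chain preserves the phase-space volume `dq dω` (Lebesgue measure on the
lift `ℝ^N × ℝ^N` of `Ω_N = (𝕋 × ℝ)^N`). Arnold, §16 Theorem 1: "The phase flow preserves volume: for
any region `D` we have volume of `gᵗD` = volume of `D`" ("In particular, for Hamilton's equations we
have `div f = ∂/∂p(-∂H/∂q) + ∂/∂q(∂H/∂p) ≡ 0`"). Proof here: the time-`t` map is the limit of
compositions of the volume-preserving shears of the symplectic Euler scheme; negative times by the
group property `Φ_{-t} ∘ Φ_t = id`. [cite: Arnold1989, §16 Thm 1] -/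
theorem IsFlow.measurePreserving (hΦ : IsFlow N ε γ Φ) (t : ℝ) :
    MeasurePreserving (Φ t) (volume : Measure (PhaseSpace N)) volume := by
  rcases le_or_gt 0 t with ht | ht
  · exact hΦ.measurePreserving_of_nonneg ht
  · have hpos := hΦ.measurePreserving_of_nonneg (neg_nonneg.2 ht.le)
    refine ⟨hΦ.measurable t, ?_⟩
    have hid : (Φ t) ∘ (Φ (-t)) = id := by
      funext z
      simp only [Function.comp_apply, id_eq]
      rw [← hΦ.map_add, add_neg_cancel, hΦ.map_zero]
    calc Measure.map (Φ t) volume = Measure.map (Φ t) (Measure.map (Φ (-t)) volume) := by rw [hpos.map_eq]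
      _ = Measure.map ((Φ t) ∘ (Φ (-t))) volume := (Measure.map_map (hΦ.measurable t) (hΦ.measurable (-t)))
      _ = volume := by rw [hid, Measure.map_id]

end Liouville

/-! ### The lattice `(2πℤ)^N` of angle shifts acting on phase space -/

/-- An element `k ∈ ℤ^N` of the lattice of angle shifts `q ↦ q + 2πk` (functions on
`Ω_N = (𝕋 × ℝ)^N` are the functions on phase space invariant under these shifts). [folklore] -/
@[ext]
structure AngleShift (N : ℕ) where
  /-- the integer vector `k` -/
  toFun : Fin N → ℤ

namespace AngleShift

/-- `AngleShift N ≃ ℤ^N`. [folklore] -/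
def equivPi (N : ℕ) : AngleShift N ≃ (Fin N → ℤ) :=
  ⟨toFun, mk, fun _ => rfl, fun _ => rfl⟩

/-- The lattice is an additive group (transported from `ℤ^N`). [folklore] -/
instance instAddCommGroup (N : ℕ) : AddCommGroup (AngleShift N) := (equivPi N).addCommGroup

/-- The lattice is countable. [folklore] -/
instance instCountable (N : ℕ) : Countable (AngleShift N) := Countable.of_equiv _ (equivPi N).symm

/-- `(k + k')_x = k_x + k'_x`. [folklore] -/
@[simp] theorem toFun_add (k k' : AngleShift N) : (k + k').toFun = k.toFun + k'.toFun := rfl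

/-- `0_x = 0`. [folklore] -/
@[simp] theorem toFun_zero : (0 : AngleShift N).toFun = 0 := rfl

/-- The translation vector `(2πk, 0)` of phase space. [folklore] -/
def toPhase (k : AngleShift N) : PhaseSpace N :=
  (fun x => (k.toFun x : ℝ) * (2 * Real.pi), 0)

/-- `toPhase` is additive. [folklore] -/
theorem toPhase_add (k k' : AngleShift N) : (k + k').toPhase = k.toPhase + k'.toPhase := by
  ext x
  · simp [toPhase, add_mul]
  · simp [toPhase]

/-- `toPhase 0 = 0`. [folklore] -/
theorem toPhase_zero : (0 : AngleShift N).toPhase = 0 := by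
  ext x <;> simp [toPhase]

/-- The action `k +ᵥ (q, ω) = (q + 2πk, ω)` of the lattice on (the lift of) phase space. [folklore] -/
instance instAddAction (N : ℕ) : AddAction (AngleShift N) (PhaseSpace N) where
  vadd k z := z + k.toPhase
  zero_vadd z := by
    show z + (0 : AngleShift N).toPhase = z
    rw [toPhase_zero, add_zero]
  add_vadd k k' z := by
    show z + (k + k').toPhase = (z + k'.toPhase) + k.toPhase
    rw [toPhase_add]; abel

/-- Unfolding the action. [folklore] -/
theorem vadd_def (k : AngleShift N) (z : PhaseSpace N) : k +ᵥ z = z + k.toPhase := rfl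

/-- The angles of `k +ᵥ z`. [folklore] -/
@[simp] theorem vadd_fst (k : AngleShift N) (z : PhaseSpace N) (x : Fin N) :
    (k +ᵥ z).1 x = z.1 x + (k.toFun x : ℝ) * (2 * Real.pi) := rfl

/-- The momenta of `k +ᵥ z`. [folklore] -/
@[simp] theorem vadd_snd (k : AngleShift N) (z : PhaseSpace N) : (k +ᵥ z).2 = z.2 := by
  simp [vadd_def, toPhase]

/-- Each shift is measurable (a translation). [folklore] -/
instance instMeasurableConstVAdd (N : ℕ) : MeasurableConstVAdd (AngleShift N) (PhaseSpace N) :=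
  ⟨fun k => by
    show Measurable fun z : PhaseSpace N => z + k.toPhase
    exact measurable_add_const _⟩

end AngleShift

open AngleShift

/-- A function (with values in any type) that is `2π`-periodic in each angle separately is
invariant under every lattice shift. [folklore] -/
theorem apply_vadd_of_periodic {α : Type*} {F : PhaseSpace N → α}
    (hF : ∀ (z : PhaseSpace N) (x : Fin N), F (Function.update z.1 x (z.1 x + 2 * Real.pi), z.2) = F z)
    (k : AngleShift N) (z : PhaseSpace N) : F (k +ᵥ z) = F z := by
  -- one coordinate, shift by `-2π`
  have hneg : ∀ (z : PhaseSpace N) (x : Fin N),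
      F (Function.update z.1 x (z.1 x - 2 * Real.pi), z.2) = F z := fun z x => by
    have := hF (Function.update z.1 x (z.1 x - 2 * Real.pi), z.2) x
    simp only [Function.update_self, Function.update_idem, sub_add_cancel, Function.update_eq_self] at this
    exact this.symm
  -- one coordinate, integer multiples
  have hint : ∀ (n : ℤ) (z : PhaseSpace N) (x : Fin N),
      F (Function.update z.1 x (z.1 x + n * (2 * Real.pi)), z.2) = F z := by
    intro n
    induction n using Int.induction_on with
    | zero => intro z x; simp
    | succ n ih =>
        intro z x
        have := hF (Function.update z.1 x (z.1 x + ((n : ℤ) : ℝ) * (2 * Real.pi)), z.2) x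
        simp only [Function.update_self, Function.update_idem] at this
        rw [show z.1 x + ((n : ℤ) + 1 : ℤ) * (2 * Real.pi) =
          z.1 x + ((n : ℤ) : ℝ) * (2 * Real.pi) + 2 * Real.pi by push_cast; ring, this, ih]
    | pred n ih =>
        intro z x
        have := hneg (Function.update z.1 x (z.1 x + (-(n : ℤ) : ℤ) * (2 * Real.pi)), z.2) x
        simp only [Function.update_self, Function.update_idem] at this
        rw [show z.1 x + ((-(n : ℤ) - 1 : ℤ)) * (2 * Real.pi) =
          z.1 x + (-(n : ℤ) : ℤ) * (2 * Real.pi) - 2 * Real.pi by push_cast; ring, this, ih]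
  -- all coordinates: induction on the set of shifted coordinates
  have hset : ∀ (s : Finset (Fin N)) (z : PhaseSpace N),
      F (z + (fun x => if x ∈ s then (k.toFun x : ℝ) * (2 * Real.pi) else 0, 0)) = F z := by
    intro s
    induction s using Finset.induction_on with
    | empty =>
        intro z
        congr 1
        ext x <;> simp
    | insert x₀ s hx₀ ih =>
        intro z
        have hsplit : (z + (fun x => if x ∈ insert x₀ s then (k.toFun x : ℝ) * (2 * Real.pi) else 0, 0)) =
            (Function.update (z + (fun x => if x ∈ s then (k.toFun x : ℝ) * (2 * Real.pi) else 0, 0)).1 x₀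
              ((z + (fun x => if x ∈ s then (k.toFun x : ℝ) * (2 * Real.pi) else 0, 0)).1 x₀ +
                k.toFun x₀ * (2 * Real.pi)),
             (z + (fun x => if x ∈ s then (k.toFun x : ℝ) * (2 * Real.pi) else 0, 0)).2) := by
          ext x
          · by_cases hx : x = x₀
            · subst hx; simp [hx₀]
            · simp [hx]
          · simp
        rw [hsplit, hint, ih]
  have := hset Finset.univ z
  simpa [vadd_def, toPhase] using this

/-- A `2π`-angle-periodic function (`IsAnglePeriodic`) is invariant under every lattice shift.
[folklore] -/
theorem IsAnglePeriodic.vadd {F : PhaseSpace N → ℝ} (hF : IsAnglePeriodic N F) (k : AngleShift N)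
    (z : PhaseSpace N) : F (k +ᵥ z) = F z :=
  apply_vadd_of_periodic hF k z

/-- The rotor Hamiltonian is a function on `Ω_N`: invariant under the lattice shifts. [folklore] -/
theorem hamiltonian_vadd (ε γ : ℝ) (k : AngleShift N) (z : PhaseSpace N) :
    hamiltonian N ε γ (k +ᵥ z) = hamiltonian N ε γ z := by
  unfold hamiltonian siteEnergy sitePotential
  refine Finset.sum_congr rfl fun x _ => ?_
  have h1 : Real.cos ((k +ᵥ z).1 x) = Real.cos (z.1 x) := by
    rw [vadd_fst, Real.cos_add_int_mul_two_pi]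
  have h2 : ∀ y, Real.cos ((k +ᵥ z).1 x - (k +ᵥ z).1 y) = Real.cos (z.1 x - z.1 y) := fun y => by
    rw [vadd_fst, vadd_fst, show z.1 x + (k.toFun x : ℝ) * (2 * Real.pi) - (z.1 y + (k.toFun y : ℝ) * (2 * Real.pi)) =
      (z.1 x - z.1 y) + ((k.toFun x - k.toFun y : ℤ) : ℝ) * (2 * Real.pi) by push_cast; ring,
      Real.cos_add_int_mul_two_pi]
  simp_rw [h2, h1, vadd_snd]

/-- The rotor field is invariant under the lattice shifts. [folklore] -/
theorem field_vadd (ε γ : ℝ) (k : AngleShift N) (z : PhaseSpace N) :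
    field N ε γ (k +ᵥ z) = field N ε γ z := by
  have hs1 : ∀ x, Real.sin ((k +ᵥ z).1 x) = Real.sin (z.1 x) := fun x => by
    rw [vadd_fst, Real.sin_add_int_mul_two_pi]
  have hs2 : ∀ x y, Real.sin ((k +ᵥ z).1 x - (k +ᵥ z).1 y) = Real.sin (z.1 x - z.1 y) := fun x y => by
    rw [vadd_fst, vadd_fst, show z.1 x + (k.toFun x : ℝ) * (2 * Real.pi) - (z.1 y + (k.toFun y : ℝ) * (2 * Real.pi)) =
      (z.1 x - z.1 y) + ((k.toFun x - k.toFun y : ℤ) : ℝ) * (2 * Real.pi) by push_cast; ring,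
      Real.sin_add_int_mul_two_pi]
  unfold field force forceCore
  ext x
  · simp
  · simp only [hs1, hs2]

/-- **Flow maps commute with the lattice shifts** (the flow lives on `Ω_N = (𝕋 × ℝ)^N`).
[cite: DeRoeckHuveneers2015, §2.1] -/
theorem IsFlow.map_vadd (hΦ : IsFlow N ε γ Φ) (k : AngleShift N) (t : ℝ) (z : PhaseSpace N) :
    Φ t (k +ᵥ z) = k +ᵥ Φ t z := by
  have h := hΦ.eq_orbit (f := fun s => k +ᵥ Φ s z) fun s => by
    have hd := (hΦ.hasDerivAt z s).add_const k.toPhase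
    rw [← field_vadd ε γ k, vadd_def] at hd
    simp_rw [vadd_def]
    exact hd
  have := congrFun h t
  simp only [hΦ.map_zero] at this
  exact this.symm

/-! ### The fundamental domain `[0, 2π)^N × ℝ^N` -/

/-- The fundamental domain is measurable. [folklore] -/
theorem measurableSet_domain (N : ℕ) : MeasurableSet (domain N) := by
  have : domain N = ⋂ x : Fin N, (fun z : PhaseSpace N => z.1 x) ⁻¹' Ico 0 (2 * Real.pi) := by
    ext z; simp [domain]
  rw [this]
  exact MeasurableSet.iInter fun x =>
    ((measurable_pi_apply x).comp measurable_fst) measurableSet_Ico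

/-- Every lattice orbit meets the fundamental domain `[0, 2π)^N × ℝ^N` exactly once. [folklore] -/
theorem existsUnique_vadd_mem_domain (z : PhaseSpace N) : ∃! k : AngleShift N, k +ᵥ z ∈ domain N := by
  have hx : ∀ x : Fin N, ∃! m : ℤ, z.1 x + m • (2 * Real.pi) ∈ Ico (0 : ℝ) (0 + 2 * Real.pi) := fun x =>
    existsUnique_add_zsmul_mem_Ico Real.two_pi_pos (z.1 x) 0
  choose m hm hmu using hx
  refine ⟨⟨m⟩, ?_, ?_⟩
  · intro x
    have := hm x
    rw [zero_add, zsmul_eq_mul] at this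
    simpa using this
  · intro k hk
    ext x
    apply hmu x
    have := hk x
    rw [zero_add, zsmul_eq_mul]
    simpa using this

/-- `[0, 2π)^N × ℝ^N` is a fundamental domain of the lattice action, for any measure. [folklore] -/
theorem isAddFundamentalDomain_domain (μ : Measure (PhaseSpace N)) :
    IsAddFundamentalDomain (AngleShift N) (domain N) μ :=
  IsAddFundamentalDomain.mk' (measurableSet_domain N).nullMeasurableSet existsUnique_vadd_mem_domain

/-- The preimage of the fundamental domain under a flow map is again a fundamental domain.
[folklore] -/
theorem IsFlow.isAddFundamentalDomain_preimage (hΦ : IsFlow N ε γ Φ) (t : ℝ) (μ : Measure (PhaseSpace N)) :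
    IsAddFundamentalDomain (AngleShift N) (Φ t ⁻¹' domain N) μ := by
  refine IsAddFundamentalDomain.mk' ((measurableSet_domain N).preimage (hΦ.measurable t)).nullMeasurableSet
    fun z => ?_
  obtain ⟨k, hk, hku⟩ := existsUnique_vadd_mem_domain (Φ t z)
  refine ⟨k, ?_, fun k' hk' => hku k' ?_⟩
  · show Φ t (k +ᵥ z) ∈ domain N
    rwa [hΦ.map_vadd]
  · have : Φ t (k' +ᵥ z) ∈ domain N := hk'
    rwa [hΦ.map_vadd] at this

/-! ### Invariance of the Gibbs state under the flow -/

/-- The (un-normalised, lifted) Gibbs density `e^{-H/T}` as an `ℝ≥0∞`-valued function. [folklore] -/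
def gibbsDensity (N : ℕ) (T ε γ : ℝ) (z : PhaseSpace N) : ℝ≥0∞ :=
  ENNReal.ofReal (gibbsWeight N T ε γ z)

/-- The Gibbs density is measurable. [folklore] -/
theorem measurable_gibbsDensity (N : ℕ) (T ε γ : ℝ) : Measurable (gibbsDensity N T ε γ) := by
  unfold gibbsDensity gibbsWeight
  exact ENNReal.measurable_ofReal.comp
    (Real.measurable_exp.comp (((contDiff_hamiltonian (N := N) ε γ (n := 0)).continuous.measurable.neg).div_const T))

/-- The Gibbs density is invariant under the lattice shifts. [folklore] -/
theorem gibbsDensity_vadd (T ε γ : ℝ) (k : AngleShift N) (z : PhaseSpace N) :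
    gibbsDensity N T ε γ (k +ᵥ z) = gibbsDensity N T ε γ z := by
  simp [gibbsDensity, gibbsWeight, hamiltonian_vadd]

/-- The Gibbs density is invariant under the flow (conservation of energy). [folklore] -/
theorem IsFlow.gibbsDensity_apply (hΦ : IsFlow N ε γ Φ) (T t : ℝ) (z : PhaseSpace N) :
    gibbsDensity N T ε γ (Φ t z) = gibbsDensity N T ε γ z := by
  simp [gibbsDensity, gibbsWeight, hΦ.hamiltonian_apply]

/-- The lifted Gibbs measure `e^{-H/T} dq dω` on the whole of phase space. [folklore] -/
def liftedGibbs (N : ℕ) (T ε γ : ℝ) : Measure (PhaseSpace N) :=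
  volume.withDensity (gibbsDensity N T ε γ)

/-- The lifted Gibbs measure is s-finite. [folklore] -/
instance instSFiniteLiftedGibbs (N : ℕ) (T ε γ : ℝ) : SFinite (liftedGibbs N T ε γ) := by
  unfold liftedGibbs; infer_instance

/-- The lifted Gibbs measure is invariant under the lattice shifts. [folklore] -/
instance vaddInvariantMeasure_liftedGibbs (N : ℕ) (T ε γ : ℝ) :
    VAddInvariantMeasure (AngleShift N) (PhaseSpace N) (liftedGibbs N T ε γ) := by
  refine ⟨fun k s hs => ?_⟩
  have hpres : MeasurePreserving (fun z : PhaseSpace N => k +ᵥ z) volume volume := by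
    haveI := isAddHaarMeasure_volume_phaseSpace N
    simp_rw [vadd_def]
    exact measurePreserving_add_right volume k.toPhase
  unfold liftedGibbs
  rw [withDensity_apply _ (hs.preimage (measurable_const_vadd k)), withDensity_apply _ hs]
  calc ∫⁻ z in (fun x => k +ᵥ x) ⁻¹' s, gibbsDensity N T ε γ z ∂volume
      = ∫⁻ z in (fun x => k +ᵥ x) ⁻¹' s, gibbsDensity N T ε γ (k +ᵥ z) ∂volume := by
        simp_rw [gibbsDensity_vadd]
    _ = ∫⁻ z in s, gibbsDensity N T ε γ z ∂volume :=
        hpres.setLIntegral_comp_preimage hs (measurable_gibbsDensity N T ε γ)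

/-- The lifted Gibbs measure is invariant under every flow map (Liouville's theorem and
conservation of energy). [cite: Arnold1989, §16 Thm 1] -/
theorem IsFlow.measurePreserving_liftedGibbs (hΦ : IsFlow N ε γ Φ)
    (T t : ℝ) : MeasurePreserving (Φ t) (liftedGibbs N T ε γ) (liftedGibbs N T ε γ) := by
  have hvol := hΦ.measurePreserving t
  refine ⟨hΦ.measurable t, Measure.ext fun s hs => ?_⟩
  unfold liftedGibbs
  rw [Measure.map_apply (hΦ.measurable t) hs, withDensity_apply _ (hs.preimage (hΦ.measurable t)),
    withDensity_apply _ hs]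
  calc ∫⁻ z in Φ t ⁻¹' s, gibbsDensity N T ε γ z ∂volume
      = ∫⁻ z in Φ t ⁻¹' s, gibbsDensity N T ε γ (Φ t z) ∂volume := by
        simp_rw [hΦ.gibbsDensity_apply]
    _ = ∫⁻ z in s, gibbsDensity N T ε γ z ∂volume :=
        hvol.setLIntegral_comp_preimage hs (measurable_gibbsDensity N T ε γ)

/-- The Gibbs state of the main file is the normalised restriction of the lifted Gibbs measure to
the fundamental domain. [folklore] -/
theorem gibbsMeasure_eq (N : ℕ) (T ε γ : ℝ) :
    gibbsMeasure N T ε γ =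
      (ENNReal.ofReal (partitionFunction N T ε γ))⁻¹ • (liftedGibbs N T ε γ).restrict (domain N) := by
  unfold gibbsMeasure liftedGibbs gibbsDensity
  rw [restrict_withDensity (measurableSet_domain N)]

/-- The Gibbs state is an s-finite measure (whatever the value of the partition function).
[folklore] -/
instance instSFiniteGibbsMeasure (N : ℕ) (T ε γ : ℝ) : SFinite (gibbsMeasure N T ε γ) := by
  rw [gibbsMeasure_eq]; infer_instance

/-- **Invariance of the Gibbs state under the dynamics** ("By invariance of the Gibbs state"):
for every flow map `X^t_ε`, every `t` and every measurable observable `F ≥ 0` on `Ω_N` (i.e.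
invariant under the lattice shifts), `⟨F ∘ X^t_ε⟩_T = ⟨F⟩_T` (Liouville + conservation of energy +
the torus periodicity, via two fundamental domains of the lattice action).
[cite: DeRoeckHuveneers2015, §7 proof of Thm 4] -/
theorem IsFlow.lintegral_comp_eq (hΦ : IsFlow N ε γ Φ) (T t : ℝ)
    {F : PhaseSpace N → ℝ≥0∞} (hFm : Measurable F) (hFp : ∀ (k : AngleShift N) (z : PhaseSpace N), F (k +ᵥ z) = F z) :
    ∫⁻ z, F (Φ t z) ∂(gibbsMeasure N T ε γ) = ∫⁻ z, F z ∂(gibbsMeasure N T ε γ) := by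
  rw [gibbsMeasure_eq, lintegral_smul_measure, lintegral_smul_measure]
  congr 1
  have hD := isAddFundamentalDomain_domain (N := N) (liftedGibbs N T ε γ)
  have hD' := hΦ.isAddFundamentalDomain_preimage t (liftedGibbs N T ε γ)
  have hinv : ∀ (k : AngleShift N) (z : PhaseSpace N), F (Φ t (k +ᵥ z)) = F (Φ t z) := fun k z => by
    rw [hΦ.map_vadd, hFp]
  calc ∫⁻ z in domain N, F (Φ t z) ∂(liftedGibbs N T ε γ)
      = ∫⁻ z in Φ t ⁻¹' domain N, F (Φ t z) ∂(liftedGibbs N T ε γ) :=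
        hD.setLIntegral_eq hD' (fun z => F (Φ t z)) hinv
    _ = ∫⁻ z in domain N, F z ∂(liftedGibbs N T ε γ) :=
        (hΦ.measurePreserving_liftedGibbs T t).setLIntegral_comp_preimage (measurableSet_domain N) hFm

/-- **Stationarity of the Gibbs state** in the form used by `AnticontinuumLocalizationEstimates`
(`lintegral_sq_timeAverage_le`, hypothesis `hinv`): for every flow map, every measurable `F ≥ 0`
that is `2π`-periodic in each angle, and every time `s`,
`∫ F ∘ Φ_s dμ_T = ∫ F dμ_T`. [cite: DeRoeckHuveneers2015, §7 ("by the invariance of the Gibbs measure")] -/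
theorem IsFlow.stationary (hΦ : IsFlow N ε γ Φ) (T : ℝ) :
    ∀ F : PhaseSpace N → ℝ≥0∞, Measurable F →
      (∀ (z : PhaseSpace N) (x : Fin N), F (Function.update z.1 x (z.1 x + 2 * Real.pi), z.2) = F z) →
      ∀ s : ℝ, ∫⁻ z, F (Φ s z) ∂(gibbsMeasure N T ε γ) = ∫⁻ z, F z ∂(gibbsMeasure N T ε γ) :=
  fun _ hFm hFp s => hΦ.lintegral_comp_eq T s hFm (apply_vadd_of_periodic hFp)

/-! ### Analytic lemmas for the proof of Theorem 4 -/

/-- `ofReal (∫₀ᵗ g) = ∫⁻_{(0,t]} ofReal g` for continuous `g ≥ 0`. [folklore] -/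
theorem ofReal_intervalIntegral_eq_lintegral {g : ℝ → ℝ} (hg : Continuous g) (hg0 : ∀ s, 0 ≤ g s)
    {t : ℝ} (ht : 0 ≤ t) :
    ENNReal.ofReal (∫ s in (0 : ℝ)..t, g s) = ∫⁻ s in Ioc 0 t, ENNReal.ofReal (g s) := by
  rw [intervalIntegral.integral_of_le ht]
  exact ofReal_integral_eq_lintegral_ofReal (hg.integrableOn_Icc.mono_set Ioc_subset_Icc_self)
    (ae_of_all _ fun s => hg0 s)

/-- **Stationarity + Fubini**: `⟨∫₀ᵗ G(X^s)² ds⟩_T = t ⟨G²⟩_T` for a continuous observable `G` on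
`Ω_N`. [cite: DeRoeckHuveneers2015, §7 proof of Thm 2] -/
theorem IsFlow.lintegral_ofReal_intervalIntegral_sq (hΦ : IsFlow N ε γ Φ)
    (T : ℝ) {G : PhaseSpace N → ℝ} (hGc : Continuous G)
    (hGp : ∀ (k : AngleShift N) (z : PhaseSpace N), G (k +ᵥ z) = G z) {t : ℝ} (ht : 0 ≤ t) :
    ∫⁻ z, ENNReal.ofReal (∫ s in (0 : ℝ)..t, G (Φ s z) ^ 2) ∂(gibbsMeasure N T ε γ) =
      ENNReal.ofReal t * ∫⁻ z, ENNReal.ofReal (G z ^ 2) ∂(gibbsMeasure N T ε γ) := by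
  have h1 : ∀ z, ENNReal.ofReal (∫ s in (0 : ℝ)..t, G (Φ s z) ^ 2) =
      ∫⁻ s in Ioc 0 t, ENNReal.ofReal (G (Φ s z) ^ 2) := fun z =>
    ofReal_intervalIntegral_eq_lintegral ((hGc.comp (hΦ.continuous_orbit z)).pow 2) (fun s => sq_nonneg _) ht
  simp_rw [h1]
  have hmeas : Measurable fun p : PhaseSpace N × ℝ => ENNReal.ofReal (G (Φ p.2 p.1) ^ 2) :=
    ENNReal.measurable_ofReal.comp
      (((hGc.comp (hΦ.continuous.comp continuous_swap)).pow 2).measurable)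
  rw [lintegral_lintegral_swap hmeas.aemeasurable]
  have h2 : ∀ s, ∫⁻ z, ENNReal.ofReal (G (Φ s z) ^ 2) ∂(gibbsMeasure N T ε γ) =
      ∫⁻ z, ENNReal.ofReal (G z ^ 2) ∂(gibbsMeasure N T ε γ) := fun s =>
    hΦ.lintegral_comp_eq T s (F := fun z => ENNReal.ofReal (G z ^ 2))
      (ENNReal.measurable_ofReal.comp ((hGc.pow 2).measurable)) (fun k z => by rw [hGp])
  simp_rw [h2]
  rw [setLIntegral_const, Real.volume_Ioc, sub_zero, mul_comm]

/-- **The one-bond estimate** (§7): if `εJ_{y,y+1} = L_H U + ε^{n+1} G` with `U, G` smooth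
functions on `Ω_N`, `⟨U²⟩_T ≤ Cε^{1/4}`, `⟨G²⟩_T ≤ C`, then for `0 ≤ t ≤ ε^{-n}`, `0 < ε ≤ 1`,
`⟨(ε ∫₀ᵗ J_{y,y+1}(X^s) ds)²⟩_T ≤ 9 C ε^{1/4}` (by `U(X^t) - U + ε^{n+1}∫₀ᵗ G(X^s)`, stationarity
and Jensen). [cite: DeRoeckHuveneers2015, §7 proof of Thm 4] -/
theorem IsFlow.bond_estimate (hΦ : IsFlow N ε γ Φ) (T : ℝ)
    (hε : 0 < ε) (hε1 : ε ≤ 1) {n : ℕ} {t : ℝ} (ht : 0 ≤ t) (htε : t ≤ ε ^ (-(n : ℝ)))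
    {C : ℝ} (hC : 0 ≤ C) (y : Fin N) {U G : PhaseSpace N → ℝ}
    (hU : ContDiff ℝ ∞ U) (hG : ContDiff ℝ ∞ G) (hUp : IsAnglePeriodic N U) (hGp : IsAnglePeriodic N G)
    (hid : ∀ z, ε * bondCurrent N y z = liouville N ε γ U z + ε ^ (n + 1) * G z)
    (hU2i : Integrable (fun z => U z ^ 2) (gibbsMeasure N T ε γ))
    (hU2 : ∫ z, U z ^ 2 ∂(gibbsMeasure N T ε γ) ≤ C * ε ^ (1 / 4 : ℝ))
    (hG2i : Integrable (fun z => G z ^ 2) (gibbsMeasure N T ε γ))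
    (hG2 : ∫ z, G z ^ 2 ∂(gibbsMeasure N T ε γ) ≤ C) :
    ∫⁻ z, ENNReal.ofReal ((ε * ∫ s in (0 : ℝ)..t, bondCurrent N y (Φ s z)) ^ 2) ∂(gibbsMeasure N T ε γ) ≤
      ENNReal.ofReal (9 * C * ε ^ (1 / 4 : ℝ)) := by
  set μ := gibbsMeasure N T ε γ
  set P : ℝ := ε ^ (n + 1) with hP
  have hinf : ((⊤ : ℕ∞) : WithTop ℕ∞) ≠ 0 := by simp
  have hUc : Continuous U := hU.continuous
  have hGc : Continuous G := hG.continuous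
  -- integrate the decomposition along the flow
  have hA : ∀ z, ε * (∫ s in (0 : ℝ)..t, bondCurrent N y (Φ s z)) =
      (U (Φ t z) - U z) + P * ∫ s in (0 : ℝ)..t, G (Φ s z) := fun z => by
    rw [← intervalIntegral.integral_const_mul]
    simp_rw [hid]
    have i1 : IntervalIntegrable (fun s => liouville N ε γ U (Φ s z)) volume 0 t :=
      ((continuous_liouville ε γ hU hinf).comp (hΦ.continuous_orbit z)).intervalIntegrable _ _
    have i2 : IntervalIntegrable (fun s => P * G (Φ s z)) volume 0 t :=
      (continuous_const.mul (hGc.comp (hΦ.continuous_orbit z))).intervalIntegrable _ _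
    rw [intervalIntegral.integral_add i1 i2, intervalIntegral.integral_const_mul,
      hΦ.integral_liouville hU hinf z 0 t, hΦ.map_zero]
  -- pointwise bound
  have hpt : ∀ z, (ε * ∫ s in (0 : ℝ)..t, bondCurrent N y (Φ s z)) ^ 2 ≤
      3 * U (Φ t z) ^ 2 + 3 * U z ^ 2 + (3 * P ^ 2 * t) * ∫ s in (0 : ℝ)..t, G (Φ s z) ^ 2 := by
    intro z
    rw [hA z]
    have hJ := sq_intervalIntegral_le (hGc.comp (hΦ.continuous_orbit z)) ht
    simp only [Function.comp_def] at hJ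
    have h3 : ((U (Φ t z) - U z) + P * ∫ s in (0 : ℝ)..t, G (Φ s z)) ^ 2 ≤
        3 * U (Φ t z) ^ 2 + 3 * U z ^ 2 + 3 * P ^ 2 * (∫ s in (0 : ℝ)..t, G (Φ s z)) ^ 2 := by
      nlinarith [sq_nonneg (U (Φ t z) + U z), sq_nonneg (U (Φ t z) - P * ∫ s in (0 : ℝ)..t, G (Φ s z)),
        sq_nonneg (U z + P * ∫ s in (0 : ℝ)..t, G (Φ s z))]
    have h4 : 3 * P ^ 2 * (∫ s in (0 : ℝ)..t, G (Φ s z)) ^ 2 ≤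
        (3 * P ^ 2 * t) * ∫ s in (0 : ℝ)..t, G (Φ s z) ^ 2 := by
      rw [mul_assoc (3 * P ^ 2) t]
      exact mul_le_mul_of_nonneg_left hJ (by positivity)
    linarith
  have hG2c : ∀ z, 0 ≤ ∫ s in (0 : ℝ)..t, G (Φ s z) ^ 2 := fun z =>
    intervalIntegral.integral_nonneg ht fun s _ => sq_nonneg _
  -- measurability
  have hmU : Measurable fun z => ENNReal.ofReal (U z ^ 2) :=
    ENNReal.measurable_ofReal.comp ((hUc.pow 2).measurable)
  have hmUt : Measurable fun z => ENNReal.ofReal (U (Φ t z) ^ 2) :=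
    hmU.comp (hΦ.measurable t)
  -- the bounds of Theorem 1 in `ℝ≥0∞` form
  have hU2' : ∫⁻ z, ENNReal.ofReal (U z ^ 2) ∂μ ≤ ENNReal.ofReal (C * ε ^ (1 / 4 : ℝ)) := by
    rw [← ofReal_integral_eq_lintegral_ofReal hU2i (ae_of_all _ fun z => sq_nonneg _)]
    exact ENNReal.ofReal_le_ofReal hU2
  have hG2' : ∫⁻ z, ENNReal.ofReal (G z ^ 2) ∂μ ≤ ENNReal.ofReal C := by
    rw [← ofReal_integral_eq_lintegral_ofReal hG2i (ae_of_all _ fun z => sq_nonneg _)]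
    exact ENNReal.ofReal_le_ofReal hG2
  -- stationarity
  have hstatU : ∫⁻ z, ENNReal.ofReal (U (Φ t z) ^ 2) ∂μ = ∫⁻ z, ENNReal.ofReal (U z ^ 2) ∂μ :=
    hΦ.lintegral_comp_eq T t (F := fun z => ENNReal.ofReal (U z ^ 2)) hmU
      (fun k z => by rw [hUp.vadd])
  have hstatG := hΦ.lintegral_ofReal_intervalIntegral_sq T hGc (fun k z => hGp.vadd k z) ht
  -- powers of `ε`
  have hPt : P * t ≤ ε := by
    calc P * t ≤ ε ^ (n + 1) * ε ^ (-(n : ℝ)) := mul_le_mul_of_nonneg_left htε (by positivity)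
      _ = ε := by
          have h1 : ((n + 1 : ℕ) : ℝ) + -(n : ℝ) = 1 := by push_cast; ring
          rw [← Real.rpow_natCast ε (n + 1), ← Real.rpow_add hε, h1, Real.rpow_one]
  have hε2 : (P * t) ^ 2 ≤ ε ^ (1 / 4 : ℝ) := by
    calc (P * t) ^ 2 ≤ ε ^ 2 := pow_le_pow_left₀ (by positivity) hPt 2
      _ = ε ^ (2 : ℝ) := by rw [← Real.rpow_natCast ε 2]; norm_num
      _ ≤ ε ^ (1 / 4 : ℝ) := Real.rpow_le_rpow_of_exponent_ge hε hε1 (by norm_num)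
  -- assemble
  have hm1 : Measurable fun z => ENNReal.ofReal 3 * ENNReal.ofReal (U (Φ t z) ^ 2) := hmUt.const_mul _
  have hm12 : Measurable fun z => ENNReal.ofReal 3 * ENNReal.ofReal (U (Φ t z) ^ 2) +
      ENNReal.ofReal 3 * ENNReal.ofReal (U z ^ 2) := hm1.add (hmU.const_mul _)
  calc ∫⁻ z, ENNReal.ofReal ((ε * ∫ s in (0 : ℝ)..t, bondCurrent N y (Φ s z)) ^ 2) ∂μ
      ≤ ∫⁻ z, (ENNReal.ofReal 3 * ENNReal.ofReal (U (Φ t z) ^ 2) + ENNReal.ofReal 3 * ENNReal.ofReal (U z ^ 2) +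
          ENNReal.ofReal (3 * P ^ 2 * t) * ENNReal.ofReal (∫ s in (0 : ℝ)..t, G (Φ s z) ^ 2)) ∂μ := by
        refine lintegral_mono fun z => (ENNReal.ofReal_le_ofReal (hpt z)).trans_eq ?_
        rw [ENNReal.ofReal_add (by positivity) (mul_nonneg (by positivity) (hG2c z)),
          ENNReal.ofReal_add (by positivity) (by positivity),
          ENNReal.ofReal_mul (q := U (Φ t z) ^ 2) (by norm_num),
          ENNReal.ofReal_mul (q := U z ^ 2) (by norm_num),
          ENNReal.ofReal_mul (q := ∫ s in (0 : ℝ)..t, G (Φ s z) ^ 2) (by positivity)]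
    _ = ENNReal.ofReal 3 * ∫⁻ z, ENNReal.ofReal (U (Φ t z) ^ 2) ∂μ +
          ENNReal.ofReal 3 * ∫⁻ z, ENNReal.ofReal (U z ^ 2) ∂μ +
          ENNReal.ofReal (3 * P ^ 2 * t) * ∫⁻ z, ENNReal.ofReal (∫ s in (0 : ℝ)..t, G (Φ s z) ^ 2) ∂μ := by
        rw [lintegral_add_left hm12, lintegral_add_left hm1,
          lintegral_const_mul' _ _ ENNReal.ofReal_ne_top, lintegral_const_mul' _ _ ENNReal.ofReal_ne_top,
          lintegral_const_mul' _ _ ENNReal.ofReal_ne_top]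
    _ = ENNReal.ofReal 3 * ∫⁻ z, ENNReal.ofReal (U z ^ 2) ∂μ +
          ENNReal.ofReal 3 * ∫⁻ z, ENNReal.ofReal (U z ^ 2) ∂μ +
          ENNReal.ofReal (3 * P ^ 2 * t) * (ENNReal.ofReal t * ∫⁻ z, ENNReal.ofReal (G z ^ 2) ∂μ) := by
        rw [hstatU, hstatG]
    _ ≤ ENNReal.ofReal 3 * ENNReal.ofReal (C * ε ^ (1 / 4 : ℝ)) +
          ENNReal.ofReal 3 * ENNReal.ofReal (C * ε ^ (1 / 4 : ℝ)) +
          ENNReal.ofReal (3 * P ^ 2 * t) * (ENNReal.ofReal t * ENNReal.ofReal C) := by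
        gcongr
    _ = ENNReal.ofReal (3 * (C * ε ^ (1 / 4 : ℝ)) + 3 * (C * ε ^ (1 / 4 : ℝ)) + 3 * P ^ 2 * t * (t * C)) := by
        rw [ENNReal.ofReal_add (by positivity) (by positivity), ENNReal.ofReal_add (by positivity) (by positivity),
          ENNReal.ofReal_mul (q := C * ε ^ (1 / 4 : ℝ)) (by norm_num),
          ENNReal.ofReal_mul (q := t * C) (by positivity), ENNReal.ofReal_mul (q := C) ht]
    _ ≤ ENNReal.ofReal (9 * C * ε ^ (1 / 4 : ℝ)) := by
        refine ENNReal.ofReal_le_ofReal ?_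
        have : 3 * P ^ 2 * t * (t * C) = 3 * C * (P * t) ^ 2 := by ring
        rw [this]
        nlinarith [mul_le_mul_of_nonneg_left hε2 hC]

/-- The tail currents are continuous. [folklore] -/
theorem continuous_tailCurrent (N : ℕ) (m : ℕ) : Continuous (tailCurrent N m) := by
  unfold tailCurrent
  refine continuous_finsetSum _ fun y _ => ?_
  split_ifs
  · exact continuous_bondCurrent y
  · exact continuous_const

/-- `z ↦ ∫₀ᵗ J(Φ_s z) ds` is continuous for a tail current `J`. [folklore] -/
theorem IsFlow.continuous_intervalIntegral_tailCurrent (hΦ : IsFlow N ε γ Φ) (m : ℕ) (t : ℝ) :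
    Continuous fun z => ∫ s in (0 : ℝ)..t, tailCurrent N m (Φ s z) :=
  intervalIntegral.continuous_parametric_intervalIntegral_of_continuous'
    (f := fun z s => tailCurrent N m (Φ s z))
    ((continuous_tailCurrent N m).comp (hΦ.continuous.comp continuous_swap)) 0 t

/-- The interval energy is continuous. [folklore] -/
theorem continuous_intervalEnergy (N : ℕ) (ε γ : ℝ) (a₁ a₂ : Fin N) :
    Continuous (intervalEnergy N ε γ a₁ a₂) := by
  unfold intervalEnergy siteEnergy sitePotential
  refine continuous_finsetSum _ fun x _ => ?_
  refine ((((continuous_apply x).comp continuous_snd).pow 2).div_const 2).add (continuous_const.mul ?_)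
  refine (continuous_const.mul (continuous_const.sub
    (Real.continuous_cos.comp ((continuous_apply x).comp continuous_fst)))).add
    (continuous_finsetSum _ fun y _ => ?_)
  split_ifs
  · exact continuous_const.sub (Real.continuous_cos.comp
      (((continuous_apply x).comp continuous_fst).sub ((continuous_apply y).comp continuous_fst)))
  · exact continuous_const

end RotorChain

end Literature.Barriers.AtomisticToContinuum.HeatConduction


namespace Literature.Barriers.AtomisticToContinuum

open Literature.MathematicalPhysics.KineticTheory.HeatConduction HeatConduction HeatConduction.RotorChain

/-- **De Roeck–Huveneers 2015, Theorem 4 from Theorem 1** (the printed proof, §7): given the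
decomposition of the current of Theorem 1 (`DeRoeckHuveneers2015_thm1`), the energy of every
discrete interval is frozen up to times `ε^{-n}`:
`⟨(H_I(X^t_ε) - H_I)²⟩_T ≤ C ε^{1/4}` for `0 ≤ t ≤ ε^{-n}` (with `C = 36 max(C₁, 1)` and
`ε < min(ε₀, 1)` in terms of the constants `C₁, ε₀` of Theorem 1). Proof: `L_H H_I =
εJ_{a₁-1,a₁} - εJ_{a₂,a₂+1}`; integrating Theorem 1 along the flow,
`H_I(X^t) - H_I = ∑_j ±(U_{a_j}(X^t) - U_{a_j} + ε^{n+1}∫₀ᵗ G_{a_j}(X^s) ds)`; by invariance of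
the Gibbs state `⟨U(X^t)²⟩ = ⟨U²⟩`, and by Jensen and invariance `⟨(∫₀ᵗG(X^s))²⟩ ≤ t²⟨G²⟩`, whence
`⟨(H_I(X^t) - H_I)²⟩ ≤ C(⟨U²⟩ + ε^{2n+2}t²⟨G²⟩) ≤ C'(ε^{1/4} + ε²)`.
[cite: DeRoeckHuveneers2015, §2.3 Thm 4 and §7 proof of Thm 4] -/
theorem DeRoeckHuveneers2015_thm4_of_thm1 (h1 : DeRoeckHuveneers2015_thm1) :
    DeRoeckHuveneers2015_thm4 := by
  intro γ hγ T hT n hn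
  obtain ⟨C, ε₀, hε₀, hmain⟩ := h1 γ hγ T hT n hn
  refine ⟨36 * max C 1, min ε₀ 1, lt_min hε₀ one_pos, ?_⟩
  intro ε hε hεε N hN Φ hΦ a₁ a₂ ha t ht htε
  have hε₀' : ε < ε₀ := hεε.trans_le (min_le_left _ _)
  have hε1 : ε ≤ 1 := (hεε.trans_le (min_le_right _ _)).le
  set μ := gibbsMeasure N T ε γ
  set Cp := max C 1 with hCp
  have hCp0 : 0 ≤ Cp := zero_le_one.trans (le_max_right _ _)
  -- the one-bond estimate for every tail current
  have hbond : ∀ m : ℕ, ∫⁻ z, ENNReal.ofReal ((ε * ∫ s in (0 : ℝ)..t, tailCurrent N m (Φ s z)) ^ 2) ∂μ ≤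
      ENNReal.ofReal (9 * Cp * ε ^ (1 / 4 : ℝ)) := by
    intro m
    by_cases hm : ∃ y : Fin N, y.val + 1 = m
    · obtain ⟨y, rfl⟩ := hm
      simp_rw [tailCurrent_succ]
      obtain ⟨U, G, hU, hG, hUp, hGp, -, -, -, -, -, -, hid, hU2i, hU2, hG2i, hG2, -⟩ :=
        hmain ε hε hε₀' N hN y
      refine hΦ.bond_estimate T hε hε1 ht htε hCp0 y hU hG hUp hGp hid hU2i ?_ hG2i ?_
      · exact hU2.trans (mul_le_mul_of_nonneg_right (le_max_left C 1) (by positivity))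
      · exact hG2.trans (le_max_left C 1)
    · push Not at hm
      simp_rw [tailCurrent_eq_zero hm]
      simp
  -- the energy of the interval
  set A₁ : PhaseSpace N → ℝ := fun z => ε * ∫ s in (0 : ℝ)..t, tailCurrent N a₁.val (Φ s z)
  set A₂ : PhaseSpace N → ℝ := fun z => ε * ∫ s in (0 : ℝ)..t, tailCurrent N (a₂.val + 1) (Φ s z)
  set D : PhaseSpace N → ℝ := fun z =>
    (intervalEnergy N ε γ a₁ a₂ (Φ t z) - intervalEnergy N ε γ a₁ a₂ z) ^ 2
  have hD : ∀ z, D z = (A₁ z - A₂ z) ^ 2 := fun z => by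
    simp only [D, A₁, A₂, hΦ.intervalEnergy_sub_eq ha z t]
  have hDle : ∀ z, D z ≤ 2 * A₁ z ^ 2 + 2 * A₂ z ^ 2 := fun z => by
    rw [hD]; nlinarith [sq_nonneg (A₁ z + A₂ z)]
  have hlin : ∫⁻ z, ENNReal.ofReal (D z) ∂μ ≤ ENNReal.ofReal (36 * Cp * ε ^ (1 / 4 : ℝ)) := by
    calc ∫⁻ z, ENNReal.ofReal (D z) ∂μ
        ≤ ∫⁻ z, (ENNReal.ofReal 2 * ENNReal.ofReal (A₁ z ^ 2) + ENNReal.ofReal 2 * ENNReal.ofReal (A₂ z ^ 2)) ∂μ := by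
          refine lintegral_mono fun z => ?_
          rw [← ENNReal.ofReal_mul (by norm_num), ← ENNReal.ofReal_mul (by norm_num),
            ← ENNReal.ofReal_add (by positivity) (by positivity)]
          exact ENNReal.ofReal_le_ofReal (hDle z)
      _ = ENNReal.ofReal 2 * ∫⁻ z, ENNReal.ofReal (A₁ z ^ 2) ∂μ +
            ENNReal.ofReal 2 * ∫⁻ z, ENNReal.ofReal (A₂ z ^ 2) ∂μ := by
          have hmA : Measurable fun z => ENNReal.ofReal 2 * ENNReal.ofReal (A₁ z ^ 2) :=
            (ENNReal.measurable_ofReal.comp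
              ((continuous_const.mul (hΦ.continuous_intervalIntegral_tailCurrent a₁.val t)).pow 2).measurable).const_mul _
          rw [lintegral_add_left hmA, lintegral_const_mul' _ _ ENNReal.ofReal_ne_top,
            lintegral_const_mul' _ _ ENNReal.ofReal_ne_top]
      _ ≤ ENNReal.ofReal 2 * ENNReal.ofReal (9 * Cp * ε ^ (1 / 4 : ℝ)) +
            ENNReal.ofReal 2 * ENNReal.ofReal (9 * Cp * ε ^ (1 / 4 : ℝ)) := by
          gcongr
          · exact hbond a₁.val
          · exact hbond (a₂.val + 1)
      _ = ENNReal.ofReal (36 * Cp * ε ^ (1 / 4 : ℝ)) := by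
          rw [← ENNReal.ofReal_mul (by norm_num), ← ENNReal.ofReal_add (by positivity) (by positivity)]
          congr 1; ring
  have hDm : AEStronglyMeasurable D μ := by
    refine Continuous.aestronglyMeasurable ?_
    exact (((continuous_intervalEnergy N ε γ a₁ a₂).comp (hΦ.continuous_at t)).sub
      (continuous_intervalEnergy N ε γ a₁ a₂)).pow 2
  have hD0 : 0 ≤ᵐ[μ] D := ae_of_all _ fun z => sq_nonneg _
  have hfin : ∫⁻ z, ENNReal.ofReal (D z) ∂μ ≠ ⊤ := ne_top_of_le_ne_top ENNReal.ofReal_ne_top hlin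
  refine ⟨(lintegral_ofReal_ne_top_iff_integrable hDm hD0).1 hfin, ?_⟩
  show ∫ z, D z ∂μ ≤ 36 * max C 1 * ε ^ (1 / 4 : ℝ)
  rw [integral_eq_lintegral_of_nonneg_ae hD0 hDm]
  exact ENNReal.toReal_le_of_le_ofReal (by positivity) hlin

end Literature.Barriers.AtomisticToContinuum

end
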